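import Summits.QuantumFields.YangMills.Theorems.BalabanUVNodesN15CurvedGluingSmoothCutDressedAdjointDefectGaugedUNTwisted
import Summits.QuantumFields.YangMills.Theorems.BalabanUVNodesN15PerCubeGreenAdjointSiteKit
import Summits.QuantumFields.YangMills.Theorems.BalabanUVNodesN15PerCubeGreenFineAdjointSiteKit
import Summits.QuantumFields.YangMills.Theorems.BalabanUVNodesN15PerCubeGreenAdjointTwoGridSiteRows
import Summits.QuantumFields.YangMills.Theorems.BalabanUVNodesN15PerCubeGreenAdjointRightEntriesTwoGrid
import Summits.QuantumFields.YangMills.Theorems.BalabanUVNodesN15PerCubeGreenAdjointTwoGridKnitSmallR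
import Summits.QuantumFields.YangMills.Theorems.BalabanUVNodesN15PerCubeGreenAdjointKnitLoc
import Summits.QuantumFields.YangMills.Theorems.BalabanUVNodesN15PerCubeGreenTwoGridGradientKnitDefect
import Summits.QuantumFields.YangMills.Theorems.BalabanUVNodesN15PerCubeGreenTwoGridSiteFits
import Summits.QuantumFields.YangMills.Theorems.BalabanUVNodesN15PerCubeGreenTwoGridNonlocalRow
import Summits.QuantumFields.YangMills.Theorems.BalabanUVNodesN15CovariantTwoGridPullbackTwistDataUN
import Summits.QuantumFields.YangMills.Theorems.BalabanUVNodesN15CovariantLandauFlatRowsAllKing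
import Summits.QuantumFields.YangMills.Theorems.BalabanUVNodesN15CovariantLandauFlatTwoGridRowFwdKing
import Summits.QuantumFields.YangMills.Theorems.BalabanUVNodesN15TwoSpacingGluingCurvedKnitDefect
import HarnessLib

/-!
# N15 = NE2, road (c) — PROGRAMME (PC), (PC-E-K) ENTRY 2 «`G′(U)∇*_U` of [B9] (3.42) for the NAMED scalar covariant Green's function, TWO GRIDS»: ★★★ THE TWO-GRID η-DEFECT OF THE
# ADJOINT KNIT ON SITES — n15-c∕427 INSTANTIATED on the (PC) site carriers with per-cube gauges, through the covariant twisted transport (dag-n15-c g37, n15-c∕429)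

Cell `pub-ymgap`, seat `pub-ymgap-dag-n15-c` (generation g37; R134 (a), s1; HUMAN RULING D-0062).  `bears_on: R4∕N15 · K3⁸ SpineGivenEndpointR13SepCoPHV (stmt-QuantumFields-27366)`;
filed `--kind proof --supports stmt-QuantumFields-27366 --as helper` — COUNT-NEUTRAL.  One theorem; 0 `def`, 0 `sorry`.  Imports BY NAME n15-c∕427 `…AdjointDefectGaugedUNTwisted`
(`uN_hasMaj_idef_rightInverse_comp_localGauges_cov_tr`), n15-c∕429c∕429f (`sc_adjointSiteKit`, `sc_adjointSiteKit'`: the 2 × 44 one-grid site facts), n15-c∕429d (`hasMaj_idef_cut∕cutF∕cutB_scCubeP`,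
`mulOp_scH'_comp_conj_comp_mulOp_scPsi'`), n15-c∕428a (`hasMaj_idef_scT_fgrad∕bgrad_plain`, `hasMaj_idef_cut_scT_fgrad∕bgrad`), n15-c∕430r (`adjSmall427R`), n15-c∕283′ (for n15-c∕282c `adjSmall`,
`adjThetaA_le`), n15-c∕413 (`abs_shift_fit_of_cross`), n15-c∕337∕338b (`abs_scBump'_…`, `abs_fgrad∕bgrad∕fgradAdj_fgrad_scH'_sub_le`, `abs_scH'_sub_scH_kingPr_le`, `hasMaj_idef_commOp_scQQ`),
n15-a `…CovariantTwoGridPullbackTwistDataUN` (`ctauS`, `kingStairT` letters), dag-n15-a Ξ-4 `flatRowsAll_king` and Ξ-7 `flatTwoGridRow_greenFgrad_king` (THE FLAT ROWS — consumed BY NAME),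
FILE 123 `cv_inv_le_two`.  Nothing in the tree is modified; nothing restated.

WHAT.  ★★★ `uN_idef_scAdj_rightInverse_tr`: for `L ≥ 7` odd there are `δ, w₀, R₀, θ₀ > 0` and, for every bound `R_b ≥ 0` of the right factors' row letters, a constant `D` such that for all
scales `(m, k, r)` (`k, r ≥ 1`, `L^m ≥ w₀`), every colour space, all unitary per-cube FINE gauges `u′_k` (coarse gauge `u′_k∘σ`), all bond fields `U, U′` (`U′` unitary), all summands
`P, P′`, perturbations `N_V, N′_V`, right factors `E, E_f` of per-cube covariant shape with their letters (DISPLAYED: the (3.35) letters on the boxes at both grids, the perturbations'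
rows, the bump-smeared species fits ∕ cut base defect ∕ adjoint far defect across King's pairing, the right factors' rows and smeared fits, the summand's right locality on the fine grid,
the (3.35) column letter `ρ`), and ANY right inverses `Y` of `Δ_{R_U} + P` and `Y′` of `Δ_{R_U′} + P′`:
`𝔇_{T,T}(Y′∘E_f, Y∘E) ≤ D·((L^k)^{−1∕4} + o + ((1+ρ)^{(d+1)(L^r−1)} − 1))·e^{−(δ∕16)|y−y′|_T}` blockwise, `T` the covariant twisted transport `ctauS` of `U′`, `o` the sum of the displayed fits.
PROOF = n15-c∕427 BY NAME with: the two site kits (one `obtain` each), the flat rows of Ξ-4 at `n = r` and Ξ-7 weakened to common constants `(max C₄ C₇, min δ₄ δ₇)`, n15-c∕429d's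
cut-row defects and right-form support, n15-c∕428a's right-entry defects (backward from Ξ-4 r11, forward from Ξ-7), n15-c∕339's two-grid producers (bump ∕ partition fits, the flat
nonlocal commutator's defect, the twist data and stair letters), the shifted-quotient fits by the identities `∇f∘S⁻¹ = ∇⁻f`, `∇⁻f∘S = ∇f`, `∇* = −∇⁻`, n15-c∕283′'s one-grid smallness
(n15-c∕282c `adjSmall`), and n15-c∕430r `adjSmall427R` for the final kernel.

HONEST FRAMING ∕ LIMITS.  MODEL carriers (doubled torus of the cover, two scales); the SHAPE of [B9] Thm 3.14's two-grid difference for the entry `G′(U)∇*_U` of (3.42) in per-cube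
gauges, NOT the printed theorem: the (3.35) data, the species fits, the summand's and the right factors' data are HYPOTHESES (discharged downstream: n15-c∕430 summand, 431 pairing),
the right inverses are ANY (identified with the named Green's functions by uniqueness, n15-c∕388).  NE2⁺ NOT PRINTED, NOT proved; N15 of record untouched (DISCHARGED AS CONSUMED,
p687738); K3⁸ OPEN; counts of record UNMOVED (typed 28∕28 · discharged 8∕27); one finite 𝕋⁴ at fixed ε per index — NOT infinite volume, NOT OS on ℝ⁴, NOT a mass gap, NOT Clay.
[cite: Balaban1985BackgroundPropagators, Thm 3.14 pp.426–427 (difference template), Thm 3.1 (3.42) p.397 (entry `G′(U)∇*_U`: shape), (3.34)–(3.35) p.396, (3.62)–(3.65) pp.402–403,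
(3.87)–(3.90) pp.409–410; Balaban1984PropagatorsII, (2.91)–(2.93) p.239, (2.133)–(2.136) p.247; Balaban1985Averaging, (125) p.36; King1986, Thm 3.3 p.656, p.664]
-/

noncomputable section

open scoped BigOperators Matrix Matrix.Norms.Frobenius

namespace Summit.QuantumFields.YangMills.BalabanUVNodes.N15.Gluing

open Real
open Literature.MathematicalPhysics.QuantumFieldTheory.Balaban1983to89
open Literature.MathematicalPhysics.QuantumFieldTheory.Balaban1983to89.B5Prop11Plancherel (Tor fine unitVec)
open Literature.MathematicalPhysics.QuantumFieldTheory.Balaban1983to89.B11SectG (BlockNorm HasMaj RowSum hasMaj_zero)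
open Literature.MathematicalPhysics.QuantumFieldTheory.Balaban1983to89.B6RandomWalk (Triangle254)
open Literature.MathematicalPhysics.QuantumFieldTheory.Balaban1983to89.B6Prop26Gluing (mulOp mulOp_apply ind ind_nonneg ind_le_one)
open Literature.MathematicalPhysics.QuantumFieldTheory.Balaban1983to89.B6UnitTorusCarrier (unitTorusGeo triangle254_unitTorusGeo rowSum_unitTorusGeo unitTorusGeo_dist unitTorusGeo_dist_nonneg
  unitTorusGeo_dist_symm unitTorusGeo_dist_self)
open Literature.MathematicalPhysics.QuantumFieldTheory.Balaban1983to89.B5SiteBridgeP12 (MP)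
open Literature.MathematicalPhysics.QuantumFieldTheory.Balaban1983to89.T4EtaRateDefect (idef idef_comp)
open Literature.MathematicalPhysics.QuantumFieldTheory.Balaban1983to89.T4EtaRateCoeffDefect (pull pull_apply)
open Literature.MathematicalPhysics.QuantumFieldTheory.King1986 (aK aK_pos aK_le)
open Literature.MathematicalPhysics.QuantumFieldTheory.King1986.Torus (blockOf tdistT tdistT_nonneg tdistT_symm)
open Literature.Barriers.QuantumFields (traceForm)
open Summit.QuantumFields.YangMills.BalabanUVNodes.N15.BackgroundLayer (fgrad fgradAdj bgrad fgrad_apply fgradAdj_apply bgrad_apply stack projO bgPropV covLapM tCoefA tCoefC unstackM fgradMat)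
open Summit.QuantumFields.YangMills.BalabanUVNodes.N15.VectorPiece (bshiftEquiv bshiftEquiv_apply kingPr kingPrV kingPrV_eq tensorId tdistT_blockOf_sub_unitVec_le kingPr_add_unitVec)
open Summit.QuantumFields.YangMills.BalabanUVNodes.N15.MatrixSpecies (mmulOp coordMat liftBlk liftMap liftEquiv liftEquiv_apply liftEquiv_symm_apply)
open Summit.QuantumFields.YangMills.BalabanUVNodes.N15.TwoGrid (paramsOf chiCube cubeBlocks chiCube_of_not_mem abs_chiCube_le_one)
open Summit.QuantumFields.YangMills.BalabanUVNodes.N15.CurvedSpecies (gaugePair uN_hasMaj_idef_rightInverse_comp_localGauges_cov_tr)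
open Summit.QuantumFields.YangMills.BalabanUVNodes.N15.CovLandau (cgrad csavg cGreen bBack flatRowsAll_king flatTwoGridRow_greenFgrad_king)
open Summit.QuantumFields.YangMills.BalabanUVNodes.N15.CovAvg (kingStairT kingSec ctauS blockOf_kingPr ctauS_coordMat_Ad_eq_conj abs_kingStairT_coordMat_Ad_transpose_le_one
  smear_cols_kingStairT_coordMat_Ad_transpose_sub_one_le smear_cols_kingStairT_coordMat_Ad_transpose_sub_one_le_kingPr)

variable {d : ℕ}

/-! ## The two-grid η-defect of the adjoint knit on sites -/

section Knit

variable {L : ℕ} [NeZero L]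

set_option maxHeartbeats 6400000 in
set_option maxRecDepth 4096 in
/-- ★★★ **THE TWO-GRID η-DEFECT OF THE ADJOINT KNIT ON SITES** (n15-c∕427 instantiated on the (PC) site carriers; see the module docstring): for EVERY right inverse `Y` of `Δ_{R_U} + P`
and `Y′` of `Δ_{R_U′} + P′` and right factors `E, E_f` of the displayed per-cube covariant shape, `𝔇_{T,T}(Y′∘E_f, Y∘E) ≤ D·((L^k)^{−1∕4} + o + ((1+ρ)^{(d+1)(L^r−1)} − 1))·e^{−(δ∕16)|y−y′|_T}`.
MODEL carriers; the SHAPE of [B9] Thm 3.14 for the entry `G′(U)∇*_U` of (3.42) with per-cube gauges, NOT the printed theorem.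
[cite: Balaban1985BackgroundPropagators, Thm 3.14 pp.426–427 (difference template), Thm 3.1 (3.42) p.397 (entry `G′(U)∇*_U`: shape), (3.34)–(3.35) p.396, (3.62)–(3.65) pp.402–403, (3.87)–(3.90) pp.409–410; Balaban1984PropagatorsII, (2.91)–(2.93) p.239, (2.133)–(2.136) p.247; Balaban1985Averaging, (125) p.36; King1986, p.664] -/
theorem uN_idef_scAdj_rightInverse_tr (hL : Odd L ∧ 1 < L) (hL7 : 7 ≤ L) {a₀ : ℝ} (ha₀ : 0 < a₀) (ι : Type) [Fintype ι] [DecidableEq ι] :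
    ∃ δ w₀ R₀ θ₀ : ℝ, 0 < δ ∧ 0 < R₀ ∧ 0 < θ₀ ∧ ∀ (Rb : ℝ), 0 ≤ Rb → ∃ D : ℝ, ∀ (mv kk r : ℕ), 1 ≤ kk → 1 ≤ r → w₀ ≤ ((L ^ mv : ℕ) : ℝ) →
      ∀ {m : Type} [Fintype m] [DecidableEq m] (e : Matrix m m ℂ ≃L[ℝ] (ι → ℝ)), (∀ A B : Matrix m m ℂ, traceForm A B = e A ⬝ᵥ e B) →
      ∀ (u' : (Fin (d + 1) → ZMod (2 * L)) → ScX' d L mv kk r hL → Matrix m m ℂ), (∀ k x', (u' k x')ᴴ * u' k x' = 1) →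
      ∀ (U : Fin (d + 1) → ScX d L mv kk hL → Matrix m m ℂ) (U' : Fin (d + 1) → ScX' d L mv kk r hL → Matrix m m ℂ), (∀ μ x', (U' μ x')ᴴ * U' μ x' = 1) →
      ∀ (P E Yop : ((ScX d L mv kk hL × ι → ℝ) →ₗ[ℝ] (ScX d L mv kk hL × ι → ℝ))) (P' Ef Yop' : ((ScX' d L mv kk r hL × ι → ℝ) →ₗ[ℝ] (ScX' d L mv kk r hL × ι → ℝ))) (NV : (Fin (d + 1) → ZMod (2 * L)) → ((ScX d L mv kk hL × ι → ℝ) →ₗ[ℝ] (ScX d L mv kk hL × ι → ℝ))) (NV' : (Fin (d + 1) → ZMod (2 * L)) → ((ScX' d L mv kk r hL × ι → ℝ) →ₗ[ℝ] (ScX' d L mv kk r hL × ι → ℝ)))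
        (RE BE : (Fin (d + 1) → ZMod (2 * L)) → ScX d L mv kk hL → Matrix ι ι ℝ) (REf BEf : (Fin (d + 1) → ZMod (2 * L)) → ScX' d L mv kk r hL → Matrix ι ι ℝ) (dh : (Fin (d + 1) → ZMod (2 * L)) → ScX d L mv kk hL → ℝ) (dhf : (Fin (d + 1) → ZMod (2 * L)) → ScX' d L mv kk r hL → ℝ) (ν : Fin (d + 1))
        (rV rD RN θF rR rR' rB oC oA og oN rfa oR oR' oB od o ρ : ℝ),
        0 ≤ rV → 0 ≤ rD → 0 ≤ RN → 0 ≤ θF → 0 ≤ rR → 0 ≤ rR' → 0 ≤ rB → 0 ≤ oC → 0 ≤ oA → 0 ≤ og → 0 ≤ oN → 0 ≤ rfa → 0 ≤ oR → 0 ≤ oR' → 0 ≤ oB → 0 ≤ od → 0 ≤ ρ →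
        rV * (1 + Fintype.card (Fin (d + 1) ⊕ Fin (d + 1))) + RN ≤ R₀ → rD ≤ R₀ → θF ≤ θ₀ → rR ≤ Rb → rR' ≤ Rb → rB ≤ Rb → oC + oA + og + oN + rfa + oR + oR' + oB + od ≤ o →
        -- COARSE GRID: the summand's conjugation law, the (3.35) letters of `Ad(u′_k(σx)U u′_k(σ(x+e_μ))ᴴ)` on the boxes, the perturbation's rows, the right factor `E` (adjoint Leibniz rule, per-cube covariant shape, rows)
        (∀ k, mmulOp (fun x => coordMat e (ContinuousLinearMap.mulLeftRight ℝ (Matrix m m ℂ) (u' k ((kingSec (cvM d L mv kk hL) L kk r) x)) (u' k ((kingSec (cvM d L mv kk hL) L kk r) x))ᴴ)) ∘ₗ P ∘ₗ mmulOp (fun x => (coordMat e (ContinuousLinearMap.mulLeftRight ℝ (Matrix m m ℂ) (u' k ((kingSec (cvM d L mv kk hL) L kk r) x)) (u' k ((kingSec (cvM d L mv kk hL) L kk r) x))ᴴ))ᵀ) = (scQQ d L mv kk hL (aK a₀ (L : ℝ) kk * (((L ^ kk : ℕ) : ℝ)) ^ (d + 1)) ι) - NV k) →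
        (∀ k x, scChi d L mv kk hL k x ≠ 0 → ∀ i, ∑ j, |(tCoefC ((((L ^ kk : ℕ) : ℝ))⁻¹) (gaugePair (scShift d L mv kk hL) fun μ x => coordMat e (ContinuousLinearMap.mulLeftRight ℝ (Matrix m m ℂ) (u' k ((kingSec (cvM d L mv kk hL) L kk r) x) * U μ x * (u' k ((kingSec (cvM d L mv kk hL) L kk r) ((scShift d L mv kk hL) μ x)))ᴴ) (u' k ((kingSec (cvM d L mv kk hL) L kk r) x) * U μ x * (u' k ((kingSec (cvM d L mv kk hL) L kk r) ((scShift d L mv kk hL) μ x)))ᴴ)ᴴ))) x i j| ≤ rV) →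
        (∀ k j' x, scChi d L mv kk hL k x ≠ 0 → ∀ i, ∑ j, |(tCoefA ((((L ^ kk : ℕ) : ℝ))⁻¹) (gaugePair (scShift d L mv kk hL) fun μ x => coordMat e (ContinuousLinearMap.mulLeftRight ℝ (Matrix m m ℂ) (u' k ((kingSec (cvM d L mv kk hL) L kk r) x) * U μ x * (u' k ((kingSec (cvM d L mv kk hL) L kk r) ((scShift d L mv kk hL) μ x)))ᴴ) (u' k ((kingSec (cvM d L mv kk hL) L kk r) x) * U μ x * (u' k ((kingSec (cvM d L mv kk hL) L kk r) ((scShift d L mv kk hL) μ x)))ᴴ)ᴴ))) j' x i j| ≤ rV) →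
        (∀ k μ x, scChi d L mv kk hL k x ≠ 0 → ∀ i, ∑ j, |fgradMat (((L ^ kk : ℕ) : ℝ)) ((scShift d L mv kk hL) μ) ((tCoefA ((((L ^ kk : ℕ) : ℝ))⁻¹) (gaugePair (scShift d L mv kk hL) fun μ x => coordMat e (ContinuousLinearMap.mulLeftRight ℝ (Matrix m m ℂ) (u' k ((kingSec (cvM d L mv kk hL) L kk r) x) * U μ x * (u' k ((kingSec (cvM d L mv kk hL) L kk r) ((scShift d L mv kk hL) μ x)))ᴴ) (u' k ((kingSec (cvM d L mv kk hL) L kk r) x) * U μ x * (u' k ((kingSec (cvM d L mv kk hL) L kk r) ((scShift d L mv kk hL) μ x)))ᴴ)ᴴ))) (Sum.inl μ)) x i j| ≤ rD) →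
        (∀ k μ x, scChi d L mv kk hL k x ≠ 0 → ∀ i, ∑ j, |fgradMat (((L ^ kk : ℕ) : ℝ)) ((scShift d L mv kk hL) μ) ((tCoefA ((((L ^ kk : ℕ) : ℝ))⁻¹) (gaugePair (scShift d L mv kk hL) fun μ x => coordMat e (ContinuousLinearMap.mulLeftRight ℝ (Matrix m m ℂ) (u' k ((kingSec (cvM d L mv kk hL) L kk r) x) * U μ x * (u' k ((kingSec (cvM d L mv kk hL) L kk r) ((scShift d L mv kk hL) μ x)))ᴴ) (u' k ((kingSec (cvM d L mv kk hL) L kk r) x) * U μ x * (u' k ((kingSec (cvM d L mv kk hL) L kk r) ((scShift d L mv kk hL) μ x)))ᴴ)ᴴ))) (Sum.inr μ)) x i j| ≤ rD) →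
        (∀ k, HasMaj (ScNorm d L mv kk hL ι) (ScNorm d L mv kk hL ι) (mulOp (fun p : ScX d L mv kk hL × ι => scPsi d L mv kk hL k p.1) ∘ₗ NV k ∘ₗ mulOp (fun p : ScX d L mv kk hL × ι => scChi d L mv kk hL k p.1)) (fun y y' => RN * Real.exp (-(δ * (unitTorusGeo L kk (cvM d L mv kk hL)).dist y y')))) →
        (∀ k, HasMaj (ScNorm d L mv kk hL ι) (ScNorm d L mv kk hL ι) (mulOp (fun p : ScX d L mv kk hL × ι => scH d L mv kk hL k p.1) ∘ₗ NV k ∘ₗ (LinearMap.id - mulOp (fun p : ScX d L mv kk hL × ι => scBump d L mv kk hL k p.1))) (fun y y' => θF * Real.exp (-(δ * (unitTorusGeo L kk (cvM d L mv kk hL)).dist y y')))) →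
        (∀ k, mulOp (fun p : ScX d L mv kk hL × ι => scH d L mv kk hL k p.1) ∘ₗ E = E ∘ₗ mulOp (fun p : ScX d L mv kk hL × ι => scH d L mv kk hL k ((scShift d L mv kk hL) ν p.1)) + mulOp (fun p : ScX d L mv kk hL × ι => dh k p.1)) →
        (∀ k x, |dh k x| ≤ (π / ((L ^ mv : ℕ) : ℝ))) →
        (∀ k, mmulOp (fun x => coordMat e (ContinuousLinearMap.mulLeftRight ℝ (Matrix m m ℂ) (u' k ((kingSec (cvM d L mv kk hL) L kk r) x)) (u' k ((kingSec (cvM d L mv kk hL) L kk r) x))ᴴ)) ∘ₗ E ∘ₗ mmulOp (fun x => (coordMat e (ContinuousLinearMap.mulLeftRight ℝ (Matrix m m ℂ) (u' k ((kingSec (cvM d L mv kk hL) L kk r) x)) (u' k ((kingSec (cvM d L mv kk hL) L kk r) x))ᴴ))ᵀ) = mmulOp (RE k) ∘ₗ bgrad (((L ^ kk : ℕ) : ℝ)) (liftEquiv ((scShift d L mv kk hL) ν) ι) + mmulOp (BE k)) →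
        (∀ k x, scChi d L mv kk hL k x ≠ 0 → ∀ i, ∑ j, |(RE k ∘ ⇑((scShift d L mv kk hL) ν)) x i j| ≤ rR) →
        (∀ k x, scChi d L mv kk hL k x ≠ 0 → ∀ i, ∑ j, |(fgradMat (((L ^ kk : ℕ) : ℝ)) ((scShift d L mv kk hL) ν) (RE k)) x i j| ≤ rR') →
        (∀ k x, scChi d L mv kk hL k x ≠ 0 → ∀ i, ∑ j, |BE k x i j| ≤ rB) →
        -- FINE GRID: the same for `u′_k`, `U′`, `P′`, `N′_V`, `E_f`
        (∀ k, mmulOp (fun x => coordMat e (ContinuousLinearMap.mulLeftRight ℝ (Matrix m m ℂ) (u' k x) (u' k x)ᴴ)) ∘ₗ P' ∘ₗ mmulOp (fun x => (coordMat e (ContinuousLinearMap.mulLeftRight ℝ (Matrix m m ℂ) (u' k x) (u' k x)ᴴ))ᵀ) = (scQQ' d L mv kk r hL (aK a₀ (L : ℝ) (r + kk) * (((L ^ r * L ^ kk : ℕ) : ℝ)) ^ (d + 1)) ι) - NV' k) →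
        (∀ k x, scChi' d L mv kk r hL k x ≠ 0 → ∀ i, ∑ j, |(tCoefC ((((L ^ r * L ^ kk : ℕ) : ℝ))⁻¹) (gaugePair (scShift' d L mv kk r hL) fun μ x => coordMat e (ContinuousLinearMap.mulLeftRight ℝ (Matrix m m ℂ) (u' k x * U' μ x * (u' k ((scShift' d L mv kk r hL) μ x))ᴴ) (u' k x * U' μ x * (u' k ((scShift' d L mv kk r hL) μ x))ᴴ)ᴴ))) x i j| ≤ rV) →
        (∀ k j' x, scChi' d L mv kk r hL k x ≠ 0 → ∀ i, ∑ j, |(tCoefA ((((L ^ r * L ^ kk : ℕ) : ℝ))⁻¹) (gaugePair (scShift' d L mv kk r hL) fun μ x => coordMat e (ContinuousLinearMap.mulLeftRight ℝ (Matrix m m ℂ) (u' k x * U' μ x * (u' k ((scShift' d L mv kk r hL) μ x))ᴴ) (u' k x * U' μ x * (u' k ((scShift' d L mv kk r hL) μ x))ᴴ)ᴴ))) j' x i j| ≤ rV) →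
        (∀ k μ x, scChi' d L mv kk r hL k x ≠ 0 → ∀ i, ∑ j, |fgradMat (((L ^ r * L ^ kk : ℕ) : ℝ)) ((scShift' d L mv kk r hL) μ) ((tCoefA ((((L ^ r * L ^ kk : ℕ) : ℝ))⁻¹) (gaugePair (scShift' d L mv kk r hL) fun μ x => coordMat e (ContinuousLinearMap.mulLeftRight ℝ (Matrix m m ℂ) (u' k x * U' μ x * (u' k ((scShift' d L mv kk r hL) μ x))ᴴ) (u' k x * U' μ x * (u' k ((scShift' d L mv kk r hL) μ x))ᴴ)ᴴ))) (Sum.inl μ)) x i j| ≤ rD) →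
        (∀ k μ x, scChi' d L mv kk r hL k x ≠ 0 → ∀ i, ∑ j, |fgradMat (((L ^ r * L ^ kk : ℕ) : ℝ)) ((scShift' d L mv kk r hL) μ) ((tCoefA ((((L ^ r * L ^ kk : ℕ) : ℝ))⁻¹) (gaugePair (scShift' d L mv kk r hL) fun μ x => coordMat e (ContinuousLinearMap.mulLeftRight ℝ (Matrix m m ℂ) (u' k x * U' μ x * (u' k ((scShift' d L mv kk r hL) μ x))ᴴ) (u' k x * U' μ x * (u' k ((scShift' d L mv kk r hL) μ x))ᴴ)ᴴ))) (Sum.inr μ)) x i j| ≤ rD) →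
        (∀ k, HasMaj ((BlockNorm.ofBlocks (unitTorusGeo L kk (cvM d L mv kk hL)) (liftBlk (scBlk d L mv kk hL ∘ kingPr L kk r (cvM d L mv kk hL)) ι))) ((BlockNorm.ofBlocks (unitTorusGeo L kk (cvM d L mv kk hL)) (liftBlk (scBlk d L mv kk hL ∘ kingPr L kk r (cvM d L mv kk hL)) ι))) (mulOp (fun p : ScX' d L mv kk r hL × ι => scPsi' d L mv kk r hL k p.1) ∘ₗ NV' k ∘ₗ mulOp (fun p : ScX' d L mv kk r hL × ι => scChi' d L mv kk r hL k p.1)) (fun y y' => RN * Real.exp (-(δ * (unitTorusGeo L kk (cvM d L mv kk hL)).dist y y')))) →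
        (∀ k, HasMaj ((BlockNorm.ofBlocks (unitTorusGeo L kk (cvM d L mv kk hL)) (liftBlk (scBlk d L mv kk hL ∘ kingPr L kk r (cvM d L mv kk hL)) ι))) ((BlockNorm.ofBlocks (unitTorusGeo L kk (cvM d L mv kk hL)) (liftBlk (scBlk d L mv kk hL ∘ kingPr L kk r (cvM d L mv kk hL)) ι))) (mulOp (fun p : ScX' d L mv kk r hL × ι => scH' d L mv kk r hL k p.1) ∘ₗ NV' k ∘ₗ (LinearMap.id - mulOp (fun p : ScX' d L mv kk r hL × ι => scBump' d L mv kk r hL k p.1))) (fun y y' => θF * Real.exp (-(δ * (unitTorusGeo L kk (cvM d L mv kk hL)).dist y y')))) →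
        (∀ k, mulOp (fun p : ScX' d L mv kk r hL × ι => scH' d L mv kk r hL k p.1) ∘ₗ Ef = Ef ∘ₗ mulOp (fun p : ScX' d L mv kk r hL × ι => scH' d L mv kk r hL k ((scShift' d L mv kk r hL) ν p.1)) + mulOp (fun p : ScX' d L mv kk r hL × ι => dhf k p.1)) →
        (∀ k x, |dhf k x| ≤ (π / ((L ^ mv : ℕ) : ℝ))) →
        (∀ k, mmulOp (fun x => coordMat e (ContinuousLinearMap.mulLeftRight ℝ (Matrix m m ℂ) (u' k x) (u' k x)ᴴ)) ∘ₗ Ef ∘ₗ mmulOp (fun x => (coordMat e (ContinuousLinearMap.mulLeftRight ℝ (Matrix m m ℂ) (u' k x) (u' k x)ᴴ))ᵀ) = mmulOp (REf k) ∘ₗ bgrad (((L ^ r * L ^ kk : ℕ) : ℝ)) (liftEquiv ((scShift' d L mv kk r hL) ν) ι) + mmulOp (BEf k)) →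
        (∀ k x, scChi' d L mv kk r hL k x ≠ 0 → ∀ i, ∑ j, |(REf k ∘ ⇑((scShift' d L mv kk r hL) ν)) x i j| ≤ rR) →
        (∀ k x, scChi' d L mv kk r hL k x ≠ 0 → ∀ i, ∑ j, |(fgradMat (((L ^ r * L ^ kk : ℕ) : ℝ)) ((scShift' d L mv kk r hL) ν) (REf k)) x i j| ≤ rR') →
        (∀ k x, scChi' d L mv kk r hL k x ≠ 0 → ∀ i, ∑ j, |BEf k x i j| ≤ rB) →
        -- TWO GRIDS: the bump-SMEARED species fits across King's pairing (values, SHIFTED first-order coefficients, their QUOTIENTS), the cut base part's and the adjoint far defect of `N_V`, the right factors' smeared fits, the Leibniz remainders' fit, the summand's RIGHT locality on the fine grid, the (3.35) COLUMN letter of the fine cubes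
        (∀ k x' i, ∑ j, |(scBump' d L mv kk r hL k x' • (tCoefC ((((L ^ r * L ^ kk : ℕ) : ℝ))⁻¹) (gaugePair (scShift' d L mv kk r hL) fun μ x => coordMat e (ContinuousLinearMap.mulLeftRight ℝ (Matrix m m ℂ) (u' k x * U' μ x * (u' k ((scShift' d L mv kk r hL) μ x))ᴴ) (u' k x * U' μ x * (u' k ((scShift' d L mv kk r hL) μ x))ᴴ)ᴴ))) x') i j - (scBump d L mv kk hL k ((kingPr L kk r (cvM d L mv kk hL)) x') • (tCoefC ((((L ^ kk : ℕ) : ℝ))⁻¹) (gaugePair (scShift d L mv kk hL) fun μ x => coordMat e (ContinuousLinearMap.mulLeftRight ℝ (Matrix m m ℂ) (u' k ((kingSec (cvM d L mv kk hL) L kk r) x) * U μ x * (u' k ((kingSec (cvM d L mv kk hL) L kk r) ((scShift d L mv kk hL) μ x)))ᴴ) (u' k ((kingSec (cvM d L mv kk hL) L kk r) x) * U μ x * (u' k ((kingSec (cvM d L mv kk hL) L kk r) ((scShift d L mv kk hL) μ x)))ᴴ)ᴴ))) ((kingPr L kk r (cvM d L mv kk hL)) x')) i j| ≤ oC) →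
        (∀ k j' x' i, ∑ j, |(scBump' d L mv kk r hL k x' • (tCoefA ((((L ^ r * L ^ kk : ℕ) : ℝ))⁻¹) (gaugePair (scShift' d L mv kk r hL) fun μ x => coordMat e (ContinuousLinearMap.mulLeftRight ℝ (Matrix m m ℂ) (u' k x * U' μ x * (u' k ((scShift' d L mv kk r hL) μ x))ᴴ) (u' k x * U' μ x * (u' k ((scShift' d L mv kk r hL) μ x))ᴴ)ᴴ))) j' x') i j - (scBump d L mv kk hL k ((kingPr L kk r (cvM d L mv kk hL)) x') • (tCoefA ((((L ^ kk : ℕ) : ℝ))⁻¹) (gaugePair (scShift d L mv kk hL) fun μ x => coordMat e (ContinuousLinearMap.mulLeftRight ℝ (Matrix m m ℂ) (u' k ((kingSec (cvM d L mv kk hL) L kk r) x) * U μ x * (u' k ((kingSec (cvM d L mv kk hL) L kk r) ((scShift d L mv kk hL) μ x)))ᴴ) (u' k ((kingSec (cvM d L mv kk hL) L kk r) x) * U μ x * (u' k ((kingSec (cvM d L mv kk hL) L kk r) ((scShift d L mv kk hL) μ x)))ᴴ)ᴴ))) j' ((kingPr L kk r (cvM d L mv kk hL)) x')) i j| ≤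 oC) →
        (∀ k μ x' i, ∑ j, |(scBump' d L mv kk r hL k (((scShift' d L mv kk r hL) μ).symm x') • (tCoefA ((((L ^ r * L ^ kk : ℕ) : ℝ))⁻¹) (gaugePair (scShift' d L mv kk r hL) fun μ x => coordMat e (ContinuousLinearMap.mulLeftRight ℝ (Matrix m m ℂ) (u' k x * U' μ x * (u' k ((scShift' d L mv kk r hL) μ x))ᴴ) (u' k x * U' μ x * (u' k ((scShift' d L mv kk r hL) μ x))ᴴ)ᴴ))) (Sum.inl μ) (((scShift' d L mv kk r hL) μ).symm x')) i j - (scBump d L mv kk hL k (((scShift d L mv kk hL) μ).symm ((kingPr L kk r (cvM d L mv kk hL)) x')) • (tCoefA ((((L ^ kk : ℕ) : ℝ))⁻¹) (gaugePair (scShift d L mv kk hL) fun μ x => coordMat e (ContinuousLinearMap.mulLeftRight ℝ (Matrix m m ℂ) (u' k ((kingSec (cvM d L mv kk hL) L kk r) x) * U μ x * (u' k ((kingSec (cvM d L mv kk hL) L kk r) ((scShift d L mv kk hL) μ x)))ᴴ) (u' k ((kingSec (cvM d L mv kk hL) L kk r) x) * U μ x * (u' k ((kingSec (cvM d L mv kk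 hL) L kk r) ((scShift d L mv kk hL) μ x)))ᴴ)ᴴ))) (Sum.inl μ) (((scShift d L mv kk hL) μ).symm ((kingPr L kk r (cvM d L mv kk hL)) x'))) i j| ≤ oA) →
        (∀ k μ x' i, ∑ j, |(scBump' d L mv kk r hL k ((scShift' d L mv kk r hL) μ x') • (tCoefA ((((L ^ r * L ^ kk : ℕ) : ℝ))⁻¹) (gaugePair (scShift' d L mv kk r hL) fun μ x => coordMat e (ContinuousLinearMap.mulLeftRight ℝ (Matrix m m ℂ) (u' k x * U' μ x * (u' k ((scShift' d L mv kk r hL) μ x))ᴴ) (u' k x * U' μ x * (u' k ((scShift' d L mv kk r hL) μ x))ᴴ)ᴴ))) (Sum.inr μ) ((scShift' d L mv kk r hL) μ x')) i j - (scBump d L mv kk hL k ((scShift d L mv kk hL) μ ((kingPr L kk r (cvM d L mv kk hL)) x')) • (tCoefA ((((L ^ kk : ℕ) : ℝ))⁻¹) (gaugePair (scShift d L mv kk hL) fun μ x => coordMat e (ContinuousLinearMap.mulLeftRight ℝ (Matrix m m ℂ) (u' k ((kingSec (cvM d L mv kk hL) L kk r) x) * U μ x * (u' k ((kingSec (cvM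 d L mv kk hL) L kk r) ((scShift d L mv kk hL) μ x)))ᴴ) (u' k ((kingSec (cvM d L mv kk hL) L kk r) x) * U μ x * (u' k ((kingSec (cvM d L mv kk hL) L kk r) ((scShift d L mv kk hL) μ x)))ᴴ)ᴴ))) (Sum.inr μ) ((scShift d L mv kk hL) μ ((kingPr L kk r (cvM d L mv kk hL)) x'))) i j| ≤ oA) →
        (∀ k μ x' i, ∑ j, |fgradMat (((L ^ r * L ^ kk : ℕ) : ℝ)) ((scShift' d L mv kk r hL) μ) (fun x => (scBump' d L mv kk r hL k x • (tCoefA ((((L ^ r * L ^ kk : ℕ) : ℝ))⁻¹) (gaugePair (scShift' d L mv kk r hL) fun μ x => coordMat e (ContinuousLinearMap.mulLeftRight ℝ (Matrix m m ℂ) (u' k x * U' μ x * (u' k ((scShift' d L mv kk r hL) μ x))ᴴ) (u' k x * U' μ x * (u' k ((scShift' d L mv kk r hL) μ x))ᴴ)ᴴ))) (Sum.inl μ) x)) (((scShift' d L mv kk r hL) μ).symm x') i j - fgradMat (((L ^ kk : ℕ) : ℝ)) ((scShift d L mv kk hL) μ) (fun x => (scBump d L mv kk hL k x • (tCoefA ((((L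 ^ kk : ℕ) : ℝ))⁻¹) (gaugePair (scShift d L mv kk hL) fun μ x => coordMat e (ContinuousLinearMap.mulLeftRight ℝ (Matrix m m ℂ) (u' k ((kingSec (cvM d L mv kk hL) L kk r) x) * U μ x * (u' k ((kingSec (cvM d L mv kk hL) L kk r) ((scShift d L mv kk hL) μ x)))ᴴ) (u' k ((kingSec (cvM d L mv kk hL) L kk r) x) * U μ x * (u' k ((kingSec (cvM d L mv kk hL) L kk r) ((scShift d L mv kk hL) μ x)))ᴴ)ᴴ))) (Sum.inl μ) x)) (((scShift d L mv kk hL) μ).symm ((kingPr L kk r (cvM d L mv kk hL)) x')) i j| ≤ og) →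
        (∀ k μ x' i, ∑ j, |fgradMat (((L ^ r * L ^ kk : ℕ) : ℝ)) ((scShift' d L mv kk r hL) μ) (fun x => (scBump' d L mv kk r hL k x • (tCoefA ((((L ^ r * L ^ kk : ℕ) : ℝ))⁻¹) (gaugePair (scShift' d L mv kk r hL) fun μ x => coordMat e (ContinuousLinearMap.mulLeftRight ℝ (Matrix m m ℂ) (u' k x * U' μ x * (u' k ((scShift' d L mv kk r hL) μ x))ᴴ) (u' k x * U' μ x * (u' k ((scShift' d L mv kk r hL) μ x))ᴴ)ᴴ))) (Sum.inr μ) x)) x' i j - fgradMat (((L ^ kk : ℕ) : ℝ)) ((scShift d L mv kk hL) μ) (fun x => (scBump d L mv kk hL k x • (tCoefA ((((L ^ kk : ℕ) : ℝ))⁻¹) (gaugePair (scShift d L mv kk hL) fun μ x => coordMat e (ContinuousLinearMap.mulLeftRight ℝ (Matrix m m ℂ) (u' k ((kingSec (cvM d L mv kk hL) L kk r) x) * U μ x * (u' k ((kingSec (cvM d L mv kk hL) L kk r) ((scShift d L mv kk hL) μ x)))ᴴ) (u' k ((kingSec (cvM d L mv kk hL) L kk r) x) * U μ x * (u' k ((kingSec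 (cvM d L mv kk hL) L kk r) ((scShift d L mv kk hL) μ x)))ᴴ)ᴴ))) (Sum.inr μ) x)) ((kingPr L kk r (cvM d L mv kk hL)) x') i j| ≤ og) →
        (∀ k, HasMaj (ScNorm d L mv kk hL ι) ((BlockNorm.ofBlocks (unitTorusGeo L kk (cvM d L mv kk hL)) (liftBlk (scBlk d L mv kk hL ∘ kingPr L kk r (cvM d L mv kk hL)) ι))) (idef (pull (liftMap (kingPr L kk r (cvM d L mv kk hL)) ι)) (pull (liftMap (kingPr L kk r (cvM d L mv kk hL)) ι)) (mulOp (fun p : ScX' d L mv kk r hL × ι => scPsi' d L mv kk r hL k p.1) ∘ₗ NV' k ∘ₗ mulOp (fun p : ScX' d L mv kk r hL × ι => scBump' d L mv kk r hL k p.1)) (mulOp (fun p : ScX d L mv kk hL × ι => scPsi d L mv kk hL k p.1) ∘ₗ NV k ∘ₗ mulOp (fun p : ScX d L mv kk hL × ι => scBump d L mv kk hL k p.1))) (fun y y' => oN * Real.exp (-(δ * (unitTorusGeo L kk (cvM d L mv kk hL)).dist y y')))) →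
        (∀ k, HasMaj (ScNorm d L mv kk hL ι) ((BlockNorm.ofBlocks (unitTorusGeo L kk (cvM d L mv kk hL)) (liftBlk (scBlk d L mv kk hL ∘ kingPr L kk r (cvM d L mv kk hL)) ι))) (idef (pull (liftMap (kingPr L kk r (cvM d L mv kk hL)) ι)) (pull (liftMap (kingPr L kk r (cvM d L mv kk hL)) ι)) (mulOp (fun p : ScX' d L mv kk r hL × ι => scH' d L mv kk r hL k p.1) ∘ₗ NV' k ∘ₗ (LinearMap.id - mulOp (fun p : ScX' d L mv kk r hL × ι => scBump' d L mv kk r hL k p.1))) (mulOp (fun p : ScX d L mv kk hL × ι => scH d L mv kk hL k p.1) ∘ₗ NV k ∘ₗ (LinearMap.id - mulOp (fun p : ScX d L mv kk hL × ι => scBump d L mv kk hL k p.1)))) (fun y y' => rfa * Real.exp (-(δ * (unitTorusGeo L kk (cvM d L mv kk hL)).dist y y')))) →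
        (∀ k x' i, ∑ j, |(fun x' => scChi' d L mv kk r hL k x' • (REf k ∘ ⇑((scShift' d L mv kk r hL) ν)) x') x' i j - (fun x => scChi d L mv kk hL k x • (RE k ∘ ⇑((scShift d L mv kk hL) ν)) x) ((kingPr L kk r (cvM d L mv kk hL)) x') i j| ≤ oR) →
        (∀ k x' i, ∑ j, |(fun x' => scChi' d L mv kk r hL k x' • (fgradMat (((L ^ r * L ^ kk : ℕ) : ℝ)) ((scShift' d L mv kk r hL) ν) (REf k)) x') x' i j - (fun x => scChi d L mv kk hL k x • (fgradMat (((L ^ kk : ℕ) : ℝ)) ((scShift d L mv kk hL) ν) (RE k)) x) ((kingPr L kk r (cvM d L mv kk hL)) x') i j| ≤ oR') →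
        (∀ k x' i, ∑ j, |(fun x' => scChi' d L mv kk r hL k x' • BEf k x') x' i j - (fun x => scChi d L mv kk hL k x • BE k x) ((kingPr L kk r (cvM d L mv kk hL)) x') i j| ≤ oB) →
        (∀ k x', |(dhf k) x' - (dh k) ((kingPr L kk r (cvM d L mv kk hL)) x')| ≤ od) →
        (∀ k, mulOp (fun p : ScX' d L mv kk r hL × ι => scH' d L mv kk r hL k p.1) ∘ₗ P' ∘ₗ mulOp (fun p : ScX' d L mv kk r hL × ι => 1 - scPsi' d L mv kk r hL k p.1) = 0) →
        (∀ k μ y', scBlk' d L mv kk r hL y' ∈ cvSk d L mv kk hL k → ∀ j, ∑ i, |(coordMat e (ContinuousLinearMap.mulLeftRight ℝ (Matrix m m ℂ) (u' k y' * U' μ y' * (u' k (y' + unitVec (fine (L ^ r * L ^ kk) (cvM d L mv kk hL)) μ))ᴴ) (u' k y' * U' μ y' * (u' k (y' + unitVec (fine (L ^ r * L ^ kk) (cvM d L mv kk hL)) μ))ᴴ)ᴴ) - 1) i j| ≤ ρ) →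
        -- ANY right inverses of `Δ_{R_U} + P` and `Δ_{R_U′} + P′`
        (covLapM (scShift d L mv kk hL) ((((L ^ kk : ℕ) : ℝ))⁻¹) (gaugePair (scShift d L mv kk hL) (fun μ x => coordMat e (ContinuousLinearMap.mulLeftRight ℝ (Matrix m m ℂ) (U μ x) (U μ x)ᴴ))) + P) ∘ₗ Yop = LinearMap.id → (covLapM (scShift' d L mv kk r hL) ((((L ^ r * L ^ kk : ℕ) : ℝ))⁻¹) (gaugePair (scShift' d L mv kk r hL) (fun μ x => coordMat e (ContinuousLinearMap.mulLeftRight ℝ (Matrix m m ℂ) (U' μ x) (U' μ x)ᴴ))) + P') ∘ₗ Yop' = LinearMap.id →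
        HasMaj (ScNorm d L mv kk hL ι) (BlockNorm.ofBlocks (unitTorusGeo L kk (cvM d L mv kk hL)) (liftBlk (scBlk d L mv kk hL ∘ kingPr L kk r (cvM d L mv kk hL)) ι)) (idef (ctauS (cvM d L mv kk hL) L kk r (fun μ x' => coordMat e (ContinuousLinearMap.mulLeftRight ℝ (Matrix m m ℂ) (U' μ x') (U' μ x')ᴴ))) (ctauS (cvM d L mv kk hL) L kk r (fun μ x' => coordMat e (ContinuousLinearMap.mulLeftRight ℝ (Matrix m m ℂ) (U' μ x') (U' μ x')ᴴ))) (Yop' ∘ₗ Ef) (Yop ∘ₗ E))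
          (fun y y' => D * ((((L : ℝ) ^ kk) ^ (-(1 / 4 : ℝ))) + (o + (((1 + ρ) ^ ((d + 1) * (L ^ r - 1)) - 1)))) * Real.exp (-(δ / 16 * (unitTorusGeo L kk (cvM d L mv kk hL)).dist y y'))) := by
  obtain ⟨hL2, hL3, hL4⟩ : 2 ≤ L ∧ 3 ≤ L ∧ 4 ≤ L := ⟨by omega, by omega, by omega⟩
  have hLpos : 0 < L := (by omega); have hL1r : (1 : ℝ) < (L : ℝ) := (by exact_mod_cast hL.2); obtain ⟨C4, δ4, hC4, hδ4, H4⟩ := flatRowsAll_king (d := d) L hL.1 hL2 ha₀ (γ := (1 / 4 : ℝ)) (by norm_num) (by norm_num); obtain ⟨C7, δ7, hC7, hδ7, H7⟩ := flatTwoGridRow_greenFgrad_king (d := d) L hL.1 hL2 ha₀ (γ := (1 / 4 : ℝ)) (by norm_num) (by norm_num); set Cs : ℝ := max C4 C7 with hCsdef; set δs : ℝ := min δ4 δ7 with hδsdef; have hCs : 0 < Cs := lt_max_of_lt_left hC4; have hδs0 : 0 < δs := lt_min hδ4 hδ7; have hC4s : C4 ≤ Cs := le_max_left _ _; have hC7s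 : C7 ≤ Cs := le_max_right _ _; have hδs4 : δs ≤ δ4 := min_le_left _ _; have hδs7 : δs ≤ δ7 := min_le_right _ _; set cr : ℝ := B4Sect5Proof.latticeConst (d + 1) (δs / 32) with hcr_def; have hcr0 : 0 ≤ cr := B4Sect5Proof.latticeConst_nonneg (d + 1) (by positivity); set δT : ℝ := δs - δs / 32 with hδTdef
  set βQ : ℝ := Cs * Real.exp δs * cr + Cs with hβQdef; have hβQ0 : 0 ≤ βQ := (by positivity); set Nov : ℝ := (((2 * L) ^ (d + 1) : ℕ) : ℝ) with hNovdef; set cι2 : ℝ := (Fintype.card ι : ℝ) ^ 2 with hcι2def; set cJ : ℝ := (Fintype.card (Fin (d + 1)) : ℝ) with hcJdef; set P₂ : ℝ := 2 * (Cs + (Cs + π * Cs)) with hP₂def; set X₂ : ℝ := 2 * βQ * cr with hX₂def; set Aθ : ℝ := Cs + cJ * (2 * (βQ + 2 * Cs)) + Cs * cr with hAθdef; set R : ℝ := 1 / (2 * ((Cs + (Cs + π * Cs)) * cr * cr) + 2 * (Aθ * cr) + 1) with hRdef; set θ₀ : ℝ := 1 / (4 * (Nov * cr * (cι2 * (P₂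 * cr))) + 1) with hθ₀def
  set AW : ℝ := cJ * (3 * P₂ * (32 * π ^ 2) + 2 * X₂ * π) + P₂ * (2 * (π * ((d : ℝ) + 1)) * a₀) * cr +
      cJ * (2 * R * (π * P₂ + π * X₂)) + P₂ * ((π * ((d : ℝ) + 1) * (Real.exp 1 * (δs / 2))⁻¹ + 2 * (π * ((d : ℝ) + 1))) * R) * cr with hAWdef
  set w₀ : ℝ := 4 * (Nov * cr * (cι2 * AW)) + 4 with hw₀def; have hNov0 : 0 ≤ Nov := (by positivity); have hR0 : 0 < R := (by positivity); have hθ₀0 : 0 < θ₀ := (by positivity); have hNov0 : 0 ≤ Nov := (by positivity)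
  refine ⟨δs, w₀, R, θ₀, hδs0, hR0, hθ₀0, fun Rb hRb => ?_⟩
  let E' : ℝ := (Real.exp 1 * (δs / 2))⁻¹; have hE'0 : 0 ≤ E' := (by positivity); let KRN : ℝ := (π * (d + 1) * E' + 2 * (π * (d + 1))) * (4 / 3 * a₀) + 2 * (π * (d + 1)) * (2 * a₀); let cι : ℝ := (Fintype.card ι : ℝ); let cJJ : ℝ := (Fintype.card (Fin (d + 1) ⊕ Fin (d + 1)) : ℝ)
  let D427 : ℝ := (((2 * (Nov * ((((((1:ℝ) * (cι2 * (((((2 * βQ) * cr) * Rb) + (((Cs + (Cs + (π * Cs))) * 2) * Rb)) + (((Cs + (Cs + (π * Cs))) * 2) * Rb)))) * (cι * (π * (d + 1) + π))) + (((1:ℝ) * (cι2 * (((((1:ℝ) * ((((((2 * βQ) * cr) * 1) + ((((2 * (((1:ℝ) * Cs) + ((π * (d + 1)) * βQ))) * cr) + ((2 * (((((((Cs * 1) + (Cs * R)) + (cJ * ((2:ℝ) * (((βQ * 1) + (Cs * R)) + ((Cs * 1) + (Cs * (R + (π * R)))))))) + (((Cs * 1) + (Cs * R)) * cr)) + ((π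 * (d + 1)) * (((Cs * R) + (cJ * ((2:ℝ) * ((βQ * R) + (Cs * (R + (π * R))))))) + ((Cs * R) * cr)))) * ((2 * βQ) * cr)) * cr)) * cr)) * Rb)) + ((((Cs + (Cs + (π * Cs))) * 2) * 1) + (((((((Cs + ((π * (d + 1)) * Cs)) + (((Cs + ((2 * (π * (d + 1))) * Cs)) + (π * Cs)) + ((32 * π ^ 4 + π ^ 2 * (d + 1)) * Cs))) * cr) + (((1:ℝ) * (((Cs + ((π * (d + 1)) * Cs)) + (((Cs + ((2 * (π * (d + 1))) * Cs)) + (π * Cs)) + ((32 * π ^ 4 + π ^ 2 * (d + 1)) * Cs))) * cr)) * ((R * ((Cs + (Cs + (π * Cs))) * 2)) * cr))) + (((((Cs + (Cs + (π * Cs))) * ((1 * ((1:ℝ) + cJJ)) + 1)) * cr) * ((Cs + (Cs + (π * Cs))) * 2)) * cr)) * 2) * Rb))) + ((((Cs + (Cs + (π * Cs))) * 2) * 1) + (((((((Cs + ((π * (d + 1)) * Cs)) + (((Cs + ((2 * (π * (d + 1))) * Cs)) + (π * Cs)) + ((32 * π ^ 4 + π ^ 2 * (d + 1)) * Cs)))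 * cr) + (((1:ℝ) * (((Cs + ((π * (d + 1)) * Cs)) + (((Cs + ((2 * (π * (d + 1))) * Cs)) + (π * Cs)) + ((32 * π ^ 4 + π ^ 2 * (d + 1)) * Cs))) * cr)) * ((R * ((Cs + (Cs + (π * Cs))) * 2)) * cr))) + (((((Cs + (Cs + (π * Cs))) * ((1 * ((1:ℝ) + cJJ)) + 1)) * cr) * ((Cs + (Cs
    + (π * Cs))) * 2)) * cr)) * 2) * Rb)))) + (0:ℝ)) + (1 * (((((2 * βQ) * cr) * Rb) + (((Cs + (Cs + (π * Cs))) * 2) * Rb)) + (((Cs + (Cs + (π * Cs))) * 2) * Rb)))) + (1 * (((((2 * βQ) * cr) * Rb) + (((Cs + (Cs + (π * Cs))) * 2) * Rb)) + (((Cs + (Cs + (π * Cs))) * 2) * Rb)))))) * (1:ℝ))) + (((cι * (π * (d + 1))) * (cι2 * (((((2 * βQ) * cr) * Rb) + (((Cs + (Cs + (π * Cs))) * 2) * Rb)) + (((Cs + (Cs + (π * Cs))) * 2) * Rb)))) * (1:ℝ))) + (((((1:ℝ) * (cι2 * ((Cs + (Cs + (π * Cs))) * 2))) * (cι * 1)) +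 (((1:ℝ) * (cι2 * ((((((((Cs + ((π * (d + 1)) * Cs)) + (((Cs + ((2 * (π * (d + 1))) * Cs)) + (π * Cs)) + ((32 * π ^ 4 + π ^ 2 * (d + 1)) * Cs))) * cr) + (((1:ℝ) * (((Cs + ((π * (d + 1)) * Cs)) + (((Cs + ((2 * (π * (d + 1))) * Cs)) + (π * Cs)) + ((32 * π ^ 4 + π ^ 2 * (d + 1)) * Cs))) * cr)) * ((R * ((Cs + (Cs + (π * Cs))) * 2)) * cr))) + (((((Cs + (Cs + (π * Cs))) * ((1 * ((1:ℝ) + cJJ)) + 1)) * cr) * ((Cs + (Cs + (π * Cs))) * 2)) * cr)) * 2) + (1 * ((Cs + (Cs + (π * Cs))) * 2))) + (1 * ((Cs + (Cs + (π * Cs))) * 2))))) * π)) + (((cι * (π * (d + 1))) * (cι2 * ((Cs + (Cs + (π * Cs))) * 2))) * π))))) * cr) + ((2 * (((Nov * (((cι2 * (((((((cJ * (((3:ℝ) * ((((Cs + (Cs + (π * Cs))) * 2) * (144 * π ^ 3 + 32 * π ^ 3 * cJ)) + (((((((Cs + ((π * (d + 1)) * Cs)) + (((Cs + ((2 * (π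 * (d + 1))) * Cs)) + (π * Cs)) + ((32 * π ^ 4 + π ^ 2 * (d + 1)) * Cs))) * cr) + (((1:ℝ) * (((Cs + ((π * (d + 1)) * Cs)) + (((Cs + ((2 * (π * (d + 1))) * Cs)) + (π * Cs)) + ((32 * π ^ 4 + π ^ 2 * (d + 1)) * Cs))) *
    cr)) * ((R * ((Cs + (Cs + (π * Cs))) * 2)) * cr))) + (((((Cs + (Cs + (π * Cs))) * ((1 * ((1:ℝ) + cJJ)) + 1)) * cr) * ((Cs + (Cs + (π * Cs))) * 2)) * cr)) * 2) * (32 * π ^ 2)))) + ((2:ℝ) * ((((2 * βQ) * cr) * (64 * π ^ 2 + π ^ 2 * cJ)) + ((((2 * (((1:ℝ) * Cs) + ((π * (d + 1)) * βQ))) * cr) + ((2 * (((((((Cs * 1) + (Cs * R)) + (cJ * ((2:ℝ) * (((βQ * 1) + (Cs * R)) + ((Cs * 1) + (Cs * (R + (π * R)))))))) + (((Cs * 1) + (Cs * R)) * cr)) + ((π * (d + 1)) * (((Cs * R) + (cJ * ((2:ℝ) * ((βQ * R) + (Cs * (R + (π * R))))))) + ((Cs * R) * cr)))) * ((2 * βQ)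 * cr)) * cr)) * cr)) * π))))) + ((((Cs + (Cs + (π * Cs))) * 2) * KRN) * cr)) + ((((((((Cs + ((π * (d + 1)) * Cs)) + (((Cs + ((2 * (π * (d + 1))) * Cs)) + (π * Cs)) + ((32 * π ^ 4 + π ^ 2 * (d + 1)) * Cs))) * cr) + (((1:ℝ) * (((Cs + ((π * (d + 1)) * Cs)) + (((Cs + ((2 * (π * (d + 1))) * Cs)) + (π * Cs)) + ((32 * π ^ 4 + π ^ 2 * (d + 1)) * Cs))) * cr)) * ((R * ((Cs + (Cs + (π * Cs))) * 2)) * cr))) + (((((Cs + (Cs + (π * Cs))) * ((1 * ((1:ℝ) + cJJ)) + 1)) * cr) * ((Cs + (Cs + (π * Cs))) * 2)) * cr)) * 2) * ((π * (d + 1) * 0 + 2 * (π * (d + 1))) * a₀)) * cr)) + (((cJ * ((2:ℝ) * ((R * ((((π * ((((((Cs + ((π * (d + 1)) * Cs)) + (((Cs + ((2 * (π * (d + 1))) * Cs)) + (π * Cs)) + ((32 * π ^ 4 + π ^ 2 * (d + 1)) * Cs))) * cr) + (((1:ℝ) * (((Cs + ((π * (d + 1)) * Cs)) + (((Cs + ((2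 * (π * (d + 1))) * Cs)) + (π * Cs)) + ((32 * π ^ 4 + π ^ 2 * (d + 1)) * Cs))) * cr)) * ((R * ((Cs + (Cs + (π * Cs))) * 2)) * cr))) + (((((Cs + (Cs + (π * Cs)))
    * ((1 * ((1:ℝ) + cJJ)) + 1)) * cr) * ((Cs + (Cs + (π * Cs))) * 2)) * cr)) * 2)) + ((64 * π ^ 2 + π ^ 2 * cJ) * ((Cs + (Cs + (π * Cs))) * 2))) + (π * (((2 * (((1:ℝ) * Cs) + ((π * (d + 1)) * βQ))) * cr) + ((2 * (((((((Cs * 1) + (Cs * R)) + (cJ * ((2:ℝ) * (((βQ * 1) + (Cs * R)) + ((Cs * 1) + (Cs * (R + (π * R)))))))) + (((Cs * 1) + (Cs * R)) * cr)) + ((π * (d + 1)) * (((Cs * R) + (cJ * ((2:ℝ) * ((βQ * R) + (Cs * (R + (π * R))))))) + ((Cs * R) * cr)))) * ((2 * βQ) * cr)) * cr)) * cr)))) + ((π + π) * ((2 * βQ) * cr)))) + (1 * ((π * ((Cs + (Cs + (π * Cs))) * 2)) + (π * ((2 * βQ) * cr))))))) + ((((Cs + (Cs + (π * Cs))) * 2)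 * (((π * (d + 1) * E' + 2 * (π * (d + 1))) * 1) + (((2:ℝ) * (π * (d + 1))) * R))) * cr)) + ((((((((Cs + ((π * (d + 1)) * Cs)) + (((Cs + ((2 * (π * (d + 1))) * Cs)) + (π * Cs)) + ((32 * π ^ 4 + π ^ 2 * (d + 1)) * Cs))) * cr) + (((1:ℝ) * (((Cs + ((π * (d + 1)) * Cs)) + (((Cs + ((2 * (π * (d + 1))) * Cs)) + (π * Cs)) + ((32 * π ^ 4 + π ^ 2 * (d + 1)) * Cs))) * cr)) * ((R * ((Cs + (Cs + (π * Cs))) * 2)) * cr))) + (((((Cs + (Cs + (π * Cs))) * ((1 * ((1:ℝ) + cJJ)) + 1)) * cr) * ((Cs + (Cs + (π * Cs))) * 2)) * cr)) * 2) * ((π * (d + 1) * E' + 2 * (π * (d + 1))) * R)) * cr))) + (((((Cs + (Cs + (π * Cs))) * 2) * 1) * cr) + ((((((((Cs + ((π * (d + 1)) * Cs)) + (((Cs + ((2 * (π * (d + 1))) * Cs)) + (π * Cs)) + ((32 * π ^ 4 + π ^ 2 * (d + 1)) * Cs))) * cr) + (((1:ℝ) * (((Cs + ((π * (d + 1)) *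 Cs)) + (((Cs + ((2 * (π * (d + 1))) * Cs)) + (π * Cs)) + ((32 * π ^ 4 + π ^ 2
    * (d + 1)) * Cs))) * cr)) * ((R * ((Cs + (Cs + (π * Cs))) * 2)) * cr))) + (((((Cs + (Cs + (π * Cs))) * ((1 * ((1:ℝ) + cJJ)) + 1)) * cr) * ((Cs + (Cs + (π * Cs))) * 2)) * cr)) * 2) * θ₀) * cr))) + (1 * (((((cJ * (((3:ℝ) * (((Cs + (Cs + (π * Cs))) * 2) * (32 * π ^ 2))) + ((2:ℝ) * (((2 * βQ) * cr) * π)))) + (0:ℝ)) + ((((Cs + (Cs + (π * Cs))) * 2) * ((π * (d + 1) * 0 + 2 * (π * (d + 1))) * a₀)) * cr)) + ((cJ * (((2:ℝ) * R) * ((π * ((Cs + (Cs + (π * Cs))) * 2)) + (π * ((2 * βQ) * cr))))) + ((((Cs + (Cs + (π * Cs))) * 2) * ((π * (d + 1) * E' + 2 * (π * (d + 1))) * R)) * cr))) + ((((Cs + (Cs + (π * Cs))) * 2) * θ₀) * cr)))) + (1 * (((((cJ * (((3:ℝ) * (((Cs + (Cs + (π * Cs))) * 2) * (32 * π ^ 2)))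 + ((2:ℝ) * (((2 * βQ) * cr) * π)))) + (0:ℝ)) + ((((Cs + (Cs + (π * Cs))) * 2) * ((π * (d + 1) * 0 + 2 * (π * (d + 1))) * a₀)) * cr)) + ((cJ * (((2:ℝ) * R) * ((π * ((Cs + (Cs + (π * Cs))) * 2)) + (π * ((2 * βQ) * cr))))) + ((((Cs + (Cs + (π * Cs))) * 2) * ((π * (d + 1) * E' + 2 * (π * (d + 1))) * R)) * cr))) + ((((Cs + (Cs + (π * Cs))) * 2) * θ₀) * cr))))) + ((cι * (π * (d + 1))) * (cι2 * (((((cJ * (((3:ℝ) * (((Cs + (Cs + (π * Cs))) * 2) * (32 * π ^ 2))) + ((2:ℝ) * (((2 * βQ) * cr) * π)))) + (0:ℝ)) + ((((Cs + (Cs + (π * Cs))) * 2) * ((π * (d + 1) * 0 + 2 * (π * (d + 1))) * a₀)) * cr)) + ((cJ * (((2:ℝ) * R) * ((π * ((Cs + (Cs + (π * Cs))) * 2)) + (π * ((2 * βQ) * cr))))) + ((((Cs + (Cs + (π * Cs))) * 2) * ((π * (d + 1) * E' + 2 * (π * (d + 1))) * R)) * cr))) + ((((Cs + (Cs + (π *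 Cs))) *
    2) * θ₀) * cr))))) + (((1:ℝ) * (cι2 * ((1 * (0:ℝ)) + (1 * (0:ℝ))))) + ((cι * (π * (d + 1))) * (cι2 * (0:ℝ)))))) * ((2 * (Nov * (((cι2 * (((((2 * βQ) * cr) * Rb) + (((Cs + (Cs + (π * Cs))) * 2) * Rb)) + (((Cs + (Cs + (π * Cs))) * 2) * Rb))) * (1:ℝ)) + ((cι2 * ((Cs + (Cs + (π * Cs))) * 2)) * π)))) * cr)) * cr)) * cr))
  refine ⟨D427, fun mv kk r hk hr hw₀ => ?_⟩
  intro m _ _ e he u' hu' U U' hU' P E Yop P' Ef Yop' NV NV' RE BE REf BEf dh dhf ν rV rD RN θF rR rR' rB oC oA og oN rfa oR oR' oB od o ρ hrV hrD hRN hθF0 hrR hrR' hrB hoC hoA hog hoN hrfa hoR hoR' hoB hod hρ0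
    hRle hrDle hθle hrRb hrR'b hrBb hole hP hCloc hAloc hDAf hDAb hNVcut hfarN hleib hdh hEcov hRE hRE' hBE hP' hCloc' hAloc' hDAf' hDAb' hNVcut' hfarN' hleib' hdhf hEcovf hREf hREf' hBEf hfitCt hfitAt hfAsh1 hfAsh2 hfgAf hfgAb hDNVc hDfarNa hfRE hfRE' hfBE hfdh hPloc' hρ hY hY'
  have hn : 1 ≤ L ^ kk := Nat.one_le_pow _ _ hLpos; have hn' : 1 ≤ L ^ r * L ^ kk := Nat.mul_pos (Nat.one_le_pow _ _ hLpos) (Nat.one_le_pow _ _ hLpos); have hWAW : 4 * (Nov * cr * (cι2 * AW)) ≤ ((L ^ mv : ℕ) : ℝ) := (by linarith only [hw₀]); have hW4R : (4 : ℝ) ≤ ((L ^ mv : ℕ) : ℝ) := (by have : 0 ≤ 4 * (Nov * cr * (cι2 * AW)) := (by positivity); linarith only [this, hw₀]); have hW2R : (2 : ℝ) ≤ ((L ^ mv : ℕ) : ℝ) := (by linarith only [hW4R]); have hW2 : 2 ≤ L ^ mv := (by exact_mod_cast hW2R); have hw : 0 < L ^ mv := (by omega); have hW1 : (1 : ℝ)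 ≤ ((L ^ mv : ℕ) : ℝ) := (by linarith only [hW2R]); have hWpos : (0 : ℝ) < ((L ^ mv : ℕ) : ℝ) := (by linarith only [hW2R])
  have hW3 : 3 ≤ L ^ mv := by
    have hmv : mv ≠ 0 := by rintro rfl; simp at hW2
    calc 3 ≤ L := hL3
      _ = L ^ 1 := (pow_one L).symm
      _ ≤ L ^ mv := Nat.pow_le_pow_right hLpos (Nat.one_le_iff_ne_zero.mpr hmv)
  have hM : ∀ ν, cvM d L mv kk hL ν = 2 * L * L ^ mv := MP_succ_eq L mv kk hL; have hMc : ∀ ν, cvM d L mv kk hL ν = 2 * L ^ (mv + 1) := fun ν => rfl; have hlo : (2 : ℝ) * ((L ^ mv : ℕ) : ℝ) ≤ ((2 * L ^ mv : ℕ) : ℝ) := (by push_cast; exact le_rfl); have hhi : ((2 * L ^ mv : ℕ) : ℝ) + ((L ^ mv : ℕ) : ℝ) + (2 + 1) * ((L ^ mv : ℕ) : ℝ) + 1 ≤ ((6 * L ^ mv + 1 : ℕ) : ℝ) := (by push_cast; linarith only []); have hS6 : 6 * L ^ mv + 1 ≤ 2 * L * L ^ mv := (by have h7 : 7 * L ^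 mv ≤ L * L ^ mv := Nat.mul_le_mul_right _ hL7; have e7 : 2 * L * L ^ mv = 2 * (L * L ^ mv) := (by ring); rw [e7]; omega)
  have hm₁ : 2 * L ^ mv ≤ coverMargin L mv := two_mul_le_coverMargin hL7 mv; have hfitI : coverMargin L mv - 2 * L ^ mv + (6 * L ^ mv + 1) ≤ L * L ^ mv := coverMargin_inner_fit hL7 hW2; have hfit0 := coverMargin_fit hL3 mv; have hfit : coverMargin L mv + 2 * L ^ mv + 1 ≤ L * L ^ mv := (by omega); have hS0 : L * L ^ mv ≤ 2 * L * L ^ mv := (by rw [mul_assoc]; omega); have hmg₂ : 2 * L ^ mv + 1 ≤ coverMargin L mv := (coverMargin_cut_margin hL7 hW3).1; have hfg₂ : coverMargin L mv - 2 * L ^ mv + (6 * L ^ mv + 1) + 1 ≤ L * L ^ mv := (coverMargin_cut_margin hL7 hW3).2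
  have h3 : 3 ≤ L ^ kk * L ^ mv :=
    calc 3 ≤ L ^ mv := hW3
      _ = 1 * L ^ mv := (one_mul _).symm
      _ ≤ L ^ kk * L ^ mv := Nat.mul_le_mul_right _ hn
  have hK0 : 0 < 2 * L := (by omega); have hK2 : 2 ≤ 2 * L := (by omega); have hLr : 0 < L ^ r := pow_pos hLpos r; let η : ℝ := (((L ^ kk : ℕ) : ℝ))⁻¹; let η' : ℝ := (((L ^ r * L ^ kk : ℕ) : ℝ))⁻¹; let W : ℝ := ((L ^ mv : ℕ) : ℝ); have hWdef : W = ((L ^ mv : ℕ) : ℝ) := rfl; have hηinv : η⁻¹ = ((L ^ kk : ℕ) : ℝ) := inv_inv _; have hη'inv : η'⁻¹ = ((L ^ r * L ^ kk : ℕ) : ℝ) := inv_inv _; have hnr : (0 : ℝ) < ((L ^ kk : ℕ) : ℝ) := (by exact_mod_cast hn); have hnr' : (0 : ℝ) < ((L ^ r * L ^ kk : ℕ) : ℝ) := (by exact_mod_cast hn'); have hη0 : 0 ≤ η := inv_nonneg.mpr hnr.le; have hη'0 : 0 ≤ η' := inv_nonneg.mpr hnr'.le; have hnR : (1 : ℝ)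 ≤ ((L ^ kk : ℕ) : ℝ) := (by exact_mod_cast hn); have hnn' : ((L ^ kk : ℕ) : ℝ) ≤ ((L ^ r * L ^ kk : ℕ) : ℝ) := (by exact_mod_cast Nat.le_mul_of_pos_left _ hLr)
  -- the site coordinates' steps and the partition letters, both grids (n15-c∕262∕263)
  have hξS := scXi_shift_lift ι hM hw (d := d) (L := L) (mv := mv) (kk := kk) (hL := hL); have hξS' := scXi'_shift_lift ι hM hw (d := d) (L := L) (mv := mv) (kk := kk) (r := r) (hL := hL); have hs0c : (0 : ℝ) ≤ ((((L ^ kk : ℕ) : ℝ)) * ((L ^ mv : ℕ) : ℝ))⁻¹ := (by positivity); have hs1c : ((((L ^ kk : ℕ) : ℝ)) * ((L ^ mv : ℕ) : ℝ))⁻¹ ≤ 1 := inv_le_one_of_one_le₀ (one_le_mul_of_one_le_of_one_le (by exact_mod_cast hn) hW1); have hs0f : (0 : ℝ) ≤ ((((L ^ r * L ^ kk : ℕ) : ℝ)) * ((L ^ mv : ℕ) : ℝ))⁻¹ := (by positivity); have hs1f : ((((L ^ r * L ^ kk : ℕ) : ℝ)) * ((L ^ mv : ℕ) : ℝ))⁻¹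 ≤ 1 := inv_le_one_of_one_le₀ (one_le_mul_of_one_le_of_one_le (by exact_mod_cast hn') hW1); have hsW : |((L ^ kk : ℕ) : ℝ)| * (π * |((((L ^ kk : ℕ) : ℝ)) * ((L ^ mv : ℕ) : ℝ))⁻¹|) = π / W := (by rw [abs_of_pos hnr, abs_of_nonneg hs0c, mul_inv, hWdef]; field_simp)
  have hsW2 : ((L ^ kk : ℕ) : ℝ) ^ 2 * (32 * π ^ 2 * (((((L ^ kk : ℕ) : ℝ)) * ((L ^ mv : ℕ) : ℝ))⁻¹) ^ 2) = 32 * π ^ 2 / W ^ 2 := (by rw [mul_inv, hWdef]; field_simp); have hsW' : |((L ^ r * L ^ kk : ℕ) : ℝ)| * (π * |((((L ^ r * L ^ kk : ℕ) : ℝ)) * ((L ^ mv : ℕ) : ℝ))⁻¹|) = π / W := (by rw [abs_of_pos hnr', abs_of_nonneg hs0f, mul_inv, hWdef]; field_simp); have hsW2' : ((L ^ r * L ^ kk : ℕ) : ℝ) ^ 2 * (32 * π ^ 2 * (((((L ^ r * L ^ kk : ℕ) : ℝ)) * ((L ^ mv : ℕ) : ℝ))⁻¹) ^ 2) = 32 *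 π ^ 2 / W ^ 2 := (by rw [mul_inv, hWdef]; field_simp)
  -- King's window and the flat rows at the masses `a_K(a₀, L, k)·n^{d+1}`, `a_K(a₀, L, r+k)·n′^{d+1}` (Ξ-4 rows 1–12)
  have haK : 0 < aK a₀ (L : ℝ) kk := aK_pos ha₀ hL1r hk; have haKle : aK a₀ (L : ℝ) kk ≤ a₀ := aK_le ha₀ hL1r hk; have ha' : 0 < aK a₀ (L : ℝ) kk * (((L ^ kk : ℕ) : ℝ)) ^ (d + 1) := (by positivity); have haK' : 0 < aK a₀ (L : ℝ) (r + kk) := aK_pos ha₀ hL1r (hk.trans (Nat.le_add_left kk r)); have haKle' : aK a₀ (L : ℝ) (r + kk) ≤ a₀ := aK_le ha₀ hL1r (hk.trans (Nat.le_add_left kk r)); have ha'' : 0 < aK a₀ (L : ℝ) (r + kk) * (((L ^ r * L ^ kk : ℕ) : ℝ)) ^ (d + 1) := (by positivity); have haKabs : |aK a₀ (L : ℝ) kk| + |aK a₀ (L : ℝ) (r + kk)| ≤ 2 * a₀ := (by rw [abs_of_pos haK, abs_of_pos haK']; linarith only [haKle, haKle'])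
  have hcNle : |aK a₀ (L : ℝ) kk * (((L ^ kk : ℕ) : ℝ)) ^ (d + 1)| * ((((L ^ kk : ℕ) : ℝ)) ^ (d + 1))⁻¹ * (2 * (π * (d + 1) / (L ^ mv : ℕ))) ≤ (π * (d + 1) / W * 0 + 2 * (π * (d + 1) / W)) * a₀ := (by rw [abs_of_pos ha', mul_assoc (aK a₀ (L : ℝ) kk), mul_inv_cancel₀ (by positivity), mul_one, mul_zero, zero_add, mul_comm]; exact mul_le_mul_of_nonneg_left haKle (by positivity)); have hcNle' : |aK a₀ (L : ℝ) (r + kk) * (((L ^ r * L ^ kk : ℕ) : ℝ)) ^ (d + 1)| * ((((L ^ r * L ^ kk : ℕ) : ℝ)) ^ (d + 1))⁻¹ * (2 * (π * (d + 1) / (L ^ mv : ℕ))) ≤ (π * (d + 1) / W * 0 + 2 * (π * (d + 1) / W)) * a₀ := (by rw [abs_of_pos ha'', mul_assoc (aK a₀ (L : ℝ) (r + kk)), mul_inv_cancel₀ (by positivity), mul_one, mul_zero, zero_add, mul_comm]; exact mul_le_mul_of_nonneg_left haKle' (by positivity))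
  have hmar₂ : 2 * L ^ mv + 1 ≤ coverMargin L mv := (coverMargin_cut_margin hL7 hW3).1; have hfitm₂ : coverMargin L mv - 2 * L ^ mv + (6 * L ^ mv + 1) + 1 ≤ L * L ^ mv := (coverMargin_cut_margin hL7 hW3).2; have hL2R : (2 : ℝ) ≤ (L : ℝ) := (by exact_mod_cast hL2); have hcι20 : 0 ≤ cι2 := (by positivity); have hrowS : RowSum (unitTorusGeo L kk (cvM d L mv kk hL)) (δs / 32) cr := (by rw [hcr_def]; exact rowSum_unitTorusGeo L kk _ (by positivity)); obtain ⟨hG0, hGF, hGA, hGB, hG0', hGF', hGA', hGB', hDG, hDGF, hDGA, hDGB⟩ := H4 kk hk r hr (mv + 1) (cvM d L mv kk hL) hMc ι; have H7r := H7 kk hk r hr (mv + 1) (cvM d L mv kk hL) hMc ι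
  have hm1 : ∀ (c δ' : ℝ) (y y' : Tor (cvM d L mv kk hL)), c ≤ Cs → δs ≤ δ' → c * Real.exp (-(δ' * tdistT (cvM d L mv kk hL) y y')) ≤ Cs * Real.exp (-(δs * tdistT (cvM d L mv kk hL) y y')) := fun c δ' y y' hc hδ' => mul_le_mul hc (Real.exp_le_exp.mpr (neg_le_neg (mul_le_mul_of_nonneg_right hδ' (tdistT_nonneg (cvM d L mv kk hL) y y')))) (Real.exp_nonneg _) hCs.le; have hεθ : 0 ≤ ((L : ℝ) ^ kk) ^ (-(1 / 4 : ℝ)) := Real.rpow_nonneg (pow_nonneg (Nat.cast_nonneg L) kk) _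
  have hm2 : ∀ (c δ' : ℝ) (y y' : Tor (cvM d L mv kk hL)), c ≤ Cs → δs ≤ δ' → c * ((L : ℝ) ^ kk) ^ (-(1 / 4 : ℝ)) * Real.exp (-(δ' * tdistT (cvM d L mv kk hL) y y')) ≤ Cs * ((L : ℝ) ^ kk) ^ (-(1 / 4 : ℝ)) * Real.exp (-(δs * tdistT (cvM d L mv kk hL) y y')) := fun c δ' y y' hc hδ' => mul_le_mul (mul_le_mul_of_nonneg_right hc hεθ) (Real.exp_le_exp.mpr (neg_le_neg (mul_le_mul_of_nonneg_right hδ' (tdistT_nonneg (cvM d L mv kk hL) y y')))) (Real.exp_nonneg _) (mul_nonneg hCs.le hεθ); have hG0s := hG0.mono fun y y' => hm1 _ _ y y' hC4s hδs4; have hGFs := hGF.mono fun y y' => hm1 _ _ y y' hC4s hδs4; have hGAs := hGA.mono fun y y' => hm1 _ _ y y' hC4s hδs4; have hGBs := hGB.mono fun y y' => hm1 _ _ y y' hC4s hδs4; have hG0's := hG0'.mono fun y y' => hm1 _ _ y y' hC4s hδs4; have hGF's := hGF'.mono fun y y' => hm1 _ _ y y' hC4s hδs4; have hGA's := hGA'.mono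 fun y y' => hm1 _ _ y y' hC4s hδs4
  have hGB's := hGB'.mono fun y y' => hm1 _ _ y y' hC4s hδs4; have hDGs := hDG.mono fun y y' => hm2 _ _ y y' hC4s hδs4; have hDGFs := hDGF.mono fun y y' => hm2 _ _ y y' hC4s hδs4; have hDGAs := hDGA.mono fun y y' => hm2 _ _ y y' hC4s hδs4; have hDGBs := hDGB.mono fun y y' => hm2 _ _ y y' hC4s hδs4; have H7s := fun μ => (H7r μ).mono fun y y' => hm2 _ _ y y' hC7s hδs7
  obtain ⟨hSχ, hSψ, hχt, hχ1, hdχt, hdχtb, hsub, hχ, hs, hsb, hdd, hddb, hNψ, hψχ, hcut, hcutF, hcutB, hTf, hTb, hTfr, hTbr, hTfψ, hTbψ, hflat0, hhabs, h236, hhcut, hh1, hh1b, hh0, hrh, hh2, hh2f, hh2b, hlayf, hlayb, hlayν, hhψ, hχth, hhts', hhtsb', hhtdd', hhtddb', hKN⟩ :=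
    sc_adjointSiteKit (d := d) hL hL7 ha₀ ι mv kk hk hW4R hCs hδs0 ν hG0s hGFs hGAs hGBs
  obtain ⟨hSχf9, hSψf9, hχtf9, hχ1f9, hdχtf9, hdχtbf9, hsubf9, hχf9, hsf9, hsbf9, hddf9, hddbf9, hNψf9, hψχf9, hcutf9, hcutFf9, hcutBf9, hTff9, hTbf9, hTfrf9, hTbrf9, hTfψf9, hTbψf9, hflat0f9, hhabsf9, h236f9, hhcutf9, hh1f9, hh1bf9, hh0f9, hrhf9, hh2f9, hh2ff9, hh2bf9, hlayff9, hlaybf9, hlayνf9, hhψf9, hχthf9, hhts'f9, hhtsb'f9, hhtdd'f9, hhtddb'f9, hKNf9⟩ :=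
    sc_adjointSiteKit' (d := d) hL hL7 ha₀ ι mv kk r hk hW4R hCs hδs0 ν hG0's hGF's hGA's hGB's
  have hJ0 : (0 : ℝ) ≤ Fintype.card (Fin (d + 1) ⊕ Fin (d + 1)) := (by positivity); have hrVR : rV ≤ R := (by nlinarith only [hRle, hRN, hrV, hJ0]); have hRNR : RN ≤ R := (by nlinarith only [hRle, hRN, hrV, hJ0]); have hRden : 1 ≤ 2 * ((Cs + (Cs + π * Cs)) * cr * cr) + 2 * (Aθ * cr) + 1 := (by have : 0 ≤ 2 * ((Cs + (Cs + π * Cs)) * cr * cr) + 2 * (Aθ * cr) := (by positivity); linarith only [this]); have hR1 : R ≤ 1 := (by rw [hRdef, div_le_one (by positivity)]; exact hRden)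
  have hq₀ : (Cs + (Cs + π / W * Cs)) * (R * cr) * cr ≤ 1 / 2 := by
    have hπw : π / W ≤ π := div_le_self pi_pos.le hW1
    have h1 : (Cs + (Cs + π / W * Cs)) * (R * cr) * cr ≤ (Cs + (Cs + π * Cs)) * (R * cr) * cr := by
      have := mul_le_mul_of_nonneg_right hπw hCs.le
      exact mul_le_mul_of_nonneg_right (mul_le_mul_of_nonneg_right (by linarith only [this]) (by positivity)) hcr0
    have h2 : (Cs + (Cs + π * Cs)) * (R * cr) * cr = ((Cs + (Cs + π * Cs)) * cr * cr) / (2 * ((Cs + (Cs + π * Cs)) * cr * cr) + 2 * (Aθ * cr) + 1) := by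
      rw [hRdef]; ring
    have h3 : ((Cs + (Cs + π * Cs)) * cr * cr) / (2 * ((Cs + (Cs + π * Cs)) * cr * cr) + 2 * (Aθ * cr) + 1) ≤ 1 / 2 := by
      rw [div_le_iff₀ (by positivity)]
      have : 0 ≤ (Cs + (Cs + π * Cs)) * cr * cr := by positivity
      have : 0 ≤ Aθ * cr := by positivity
      linarith
    linarith only [h1, h2, h3]
  have hθA : (Cs * rV + Fintype.card (Fin (d + 1)) * (2 * (βQ * rV + Cs * (rD + (π / W) * rV))) + Cs * RN * cr) * cr ≤ 1 / 2 := by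
    have h1 := adjThetaA_le (cJ := (Fintype.card (Fin (d + 1)) : ℝ)) hCs.le hβQ0 (by positivity) hcr0 (div_le_one_of_le₀ (by linarith only [Real.pi_le_four, hW4R] : π ≤ W) hWpos.le) hrV hrVR
      (hrDle.trans le_rfl) hRNR
    have h2 : (Cs + (Fintype.card (Fin (d + 1)) : ℝ) * (2 * (βQ + 2 * Cs)) + Cs * cr) * R * cr ≤ 1 / 2 := by
      rw [← hcJdef, ← hAθdef]
      have e : Aθ * R * cr = (Aθ * cr) / (2 * ((Cs + (Cs + π * Cs)) * cr * cr) + 2 * (Aθ * cr) + 1) := by rw [hRdef]; ring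
      rw [e, div_le_iff₀ (by positivity)]
      have : 0 ≤ (Cs + (Cs + π * Cs)) * cr * cr := by positivity
      have : 0 ≤ Aθ * cr := by positivity
      linarith
    calc _ ≤ (Cs + (Fintype.card (Fin (d + 1)) : ℝ) * (2 * (βQ + 2 * Cs)) + Cs * cr) * R * cr := mul_le_mul_of_nonneg_right h1 hcr0
      _ ≤ 1 / 2 := h2
  have hsA : (Cs * rV + Fintype.card (Fin (d + 1)) * (2 * (βQ * rV + Cs * (rD + (π / W) * rV))) + Cs * RN * cr) * cr < 1 := hθA.trans_lt (by norm_num); have hθbud : Nov * cr * (cι2 * ((2 * (Cs + (Cs + π * Cs))) * θF * cr)) ≤ 1 / 4 := (by rw [← hP₂def]; have hX : 0 ≤ Nov * cr * (cι2 * (P₂ * cr)) := (by positivity); have e1 : Nov * cr * (cι2 * (P₂ * θF * cr)) = θF * (Nov * cr * (cι2 * (P₂ * cr))) := (by ring); have h2 : θF * (Nov * cr * (cι2 * (P₂ * cr))) ≤ θ₀ * (Nov * cr * (cι2 * (P₂ * cr))) := mul_le_mul_of_nonneg_right hθle hX; rw [e1]; refine h2.trans ?_; rw [hθ₀def, div_mul_eq_mul_div,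 one_mul, div_le_iff₀ (by positivity)]; linarith only [hX])
  have hsmall := adjSmall (Nov := Nov) (cr := cr) (cι2 := cι2) (cJ := (Fintype.card (Fin (d + 1)) : ℝ)) (β := Cs) (β₁ := Cs) (βQ := βQ) (w := W) (R := R) (θF := θF)
    (θA := Cs * rV + Fintype.card (Fin (d + 1)) * (2 * (βQ * rV + Cs * (rD + (π / W) * rV))) + Cs * RN * cr) (rV := rV) (RN := RN) (rR := rR) (rR' := rR') (rB := rB)
    (ε := δs / 2) (cN₀ := a₀) (D := (d : ℝ) + 1)
    hNov0 hcr0 (by positivity) (by positivity) hCs.le hCs.le hβQ0 hW1 hR0.le hθF0 (by positivity) ha₀.le (by positivity) hRN hrVR hRNR hrR hrR' hrB hq₀ hθA hθbud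
    (by rw [← hcJdef, ← hP₂def, ← hX₂def, ← hAWdef]; exact hWAW)
  -- the two-grid letter `(L^k)^{−1∕4}` and the size `S`
  let εk : ℝ := ((L : ℝ) ^ kk) ^ (-(1 / 4 : ℝ)); have hLk1 : (1 : ℝ) ≤ (L : ℝ) ^ kk := (by rw [← Nat.cast_pow]; exact hnR); have hεk0 : 0 ≤ εk := Real.rpow_nonneg (by positivity) _; have hnε : (((L ^ kk : ℕ) : ℝ))⁻¹ ≤ εk := (by rw [Nat.cast_pow, ← Real.rpow_neg_one]; exact Real.rpow_le_rpow_of_exponent_le hLk1 (by norm_num)); have hw1 : W⁻¹ ≤ 1 := inv_le_one_of_one_le₀ hW1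
  have hnwε : ((((L ^ kk : ℕ) : ℝ)) * W)⁻¹ ≤ εk :=
    calc ((((L ^ kk : ℕ) : ℝ)) * W)⁻¹ = (((L ^ kk : ℕ) : ℝ))⁻¹ * W⁻¹ := by rw [mul_inv]
      _ ≤ (((L ^ kk : ℕ) : ℝ))⁻¹ * 1 := mul_le_mul_of_nonneg_left hw1 (by positivity)
      _ ≤ εk := by rw [mul_one]; exact hnε
  have hn'ε : (((L ^ r * L ^ kk : ℕ) : ℝ))⁻¹ ≤ εk := (inv_anti₀ hnr hnn').trans hnε; let sS : ℝ := (1 + ρ) ^ ((d + 1) * (L ^ r - 1)) - 1; have hsS0 : 0 ≤ sS := (by have h1 := one_le_pow₀ (M₀ := ℝ) (a := 1 + ρ) (by linarith only [hρ0]) (n := (d + 1) * (L ^ r - 1)); show 0 ≤ (1 + ρ) ^ ((d + 1) * (L ^ r - 1)) - 1; linarith only [h1]); let Sdef : ℝ := εk + (o + (sS + rD)); have ho0 : 0 ≤ o := le_trans (by positivity) hole; have hεS : εk ≤ Sdef := (by show εk ≤ εk + (o + (sS + rD)); linarith only [ho0, hsS0, hrD])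
  -- the two-grid letters of the cover
  let O1 : ℝ := |W⁻¹| * (((L ^ kk : ℕ) : ℝ) * W)⁻¹ * (64 * π ^ 2 + π ^ 2 * Fintype.card (Fin (d + 1))); let O2 : ℝ := W⁻¹ ^ 2 * (((L ^ kk : ℕ) : ℝ) * W)⁻¹ * (144 * π ^ 3 + 32 * π ^ 3 * Fintype.card (Fin (d + 1)))
  let RNK : ℝ := (π * (d + 1) / (L ^ mv : ℕ) * (Real.exp 1 * (δs / 2))⁻¹ + 2 * (π * (d + 1) / (L ^ mv : ℕ))) * (4 / 3 * a₀ * ((L : ℝ) ^ kk) ^ (-(1 / 4 : ℝ))) +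
    2 * (π * (d + 1) / (((L ^ kk : ℕ) : ℝ) * (L ^ mv : ℕ))) * (|aK a₀ (L : ℝ) kk| + |aK a₀ (L : ℝ) (r + kk)|)
  have hoχ0 : 0 ≤ π * (d + 1) / (((L ^ kk : ℕ) : ℝ) * W) := div_nonneg (by positivity) (mul_nonneg hnr.le hWpos.le); have hoχ₂0 : 0 ≤ (W)⁻¹ * (((L ^ kk : ℕ) : ℝ) * W)⁻¹ * (32 * π ^ 4 + π ^ 2 * (d + 1)) := mul_nonneg (mul_nonneg (inv_nonneg.mpr hWpos.le) (inv_nonneg.mpr (mul_nonneg hnr.le hWpos.le))) (by positivity); have ho₁0 : 0 ≤ O1 := mul_nonneg (mul_nonneg (abs_nonneg _) (inv_nonneg.mpr (mul_nonneg hnr.le hWpos.le))) (by positivity); have ho₂0 : 0 ≤ O2 := mul_nonneg (mul_nonneg (pow_nonneg (inv_nonneg.mpr hWpos.le) 2) (inv_nonneg.mpr (mul_nonneg hnr.le hWpos.le))) (by positivity)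
  have hRNK0 : 0 ≤ RNK := (by positivity); have hℓ1 : π * (d + 1) / W ≤ π * (d + 1) := div_le_self (by positivity) hW1; have hLRb : π * (d + 1) / W * (Real.exp 1 * (δs / 2))⁻¹ + 2 * (π * (d + 1) / W) ≤ π * (d + 1) * E' + 2 * (π * (d + 1)) := add_le_add (mul_le_mul_of_nonneg_right hℓ1 hE'0) (by linarith only [hℓ1]); have hLR20 : 0 ≤ π * (d + 1) / W * (Real.exp 1 * (δs / 2))⁻¹ + 2 * (π * (d + 1) / W + π * (d + 1) / W * 1) := (by positivity); have hLRb2 : π * (d + 1) / W * (Real.exp 1 * (δs / 2))⁻¹ + 2 * (π * (d + 1) / W + π * (d + 1) / W * 1) ≤ π * (d + 1) * E' + 2 * (π * (d + 1) + π * (d + 1) * 1) := add_le_add (mul_le_mul_of_nonneg_right hℓ1 hE'0) (by linarith only [hℓ1]); have hcNb : (π * (d + 1) / W * 0 + 2 * (π * (d + 1) / W)) * a₀ ≤ (π * (d + 1) * 0 + 2 * (π * (d + 1))) * a₀ := mul_le_mul_of_nonneg_right (by linarith only [hℓ1]) ha₀.le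
  let Sdef : ℝ := εk + (o + sS); have ho0 : 0 ≤ o := le_trans (by positivity) hole; have hεS : εk ≤ Sdef := (by show εk ≤ εk + (o + sS); linarith only [ho0, hsS0]); have hSdef0 : 0 ≤ Sdef := le_trans hεk0 hεS; have hsoχ : π * (d + 1) / (((L ^ kk : ℕ) : ℝ) * W) ≤ π * (d + 1) * Sdef := (by rw [div_eq_mul_inv]; exact mul_le_mul_of_nonneg_left (hnwε.trans hεS) (by positivity)); have hsoχ₁ : 2 * (π * (d + 1) / (((L ^ kk : ℕ) : ℝ) * W)) ≤ 2 * (π * (d + 1)) * Sdef := (by rw [mul_assoc]; exact mul_le_mul_of_nonneg_left hsoχ zero_le_two)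
  have hsoχ₂ : (W)⁻¹ * (((L ^ kk : ℕ) : ℝ) * W)⁻¹ * (32 * π ^ 4 + π ^ 2 * (d + 1)) ≤ (32 * π ^ 4 + π ^ 2 * (d + 1)) * Sdef :=
    calc (W)⁻¹ * (((L ^ kk : ℕ) : ℝ) * W)⁻¹ * (32 * π ^ 4 + π ^ 2 * (d + 1)) ≤ 1 * Sdef * (32 * π ^ 4 + π ^ 2 * (d + 1)) := mul_le_mul_of_nonneg_right (mul_le_mul hw1 (hnwε.trans hεS) (inv_nonneg.mpr (mul_nonneg hnr.le hWpos.le)) zero_le_one) (by positivity)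
      _ = (32 * π ^ 4 + π ^ 2 * (d + 1)) * Sdef := by ring
  have hwabs : |W⁻¹| ≤ 1 := (by rw [abs_of_nonneg (inv_nonneg.mpr hWpos.le)]; exact hw1)
  have hso₁ : O1 ≤ (64 * π ^ 2 + π ^ 2 * Fintype.card (Fin (d + 1))) * Sdef :=
    calc O1 ≤ 1 * Sdef * (64 * π ^ 2 + π ^ 2 * Fintype.card (Fin (d + 1))) := mul_le_mul_of_nonneg_right (mul_le_mul hwabs (hnwε.trans hεS) (inv_nonneg.mpr (mul_nonneg hnr.le hWpos.le)) zero_le_one) (by positivity)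
      _ = (64 * π ^ 2 + π ^ 2 * Fintype.card (Fin (d + 1))) * Sdef := by ring
  have hso₂ : O2 ≤ (144 * π ^ 3 + 32 * π ^ 3 * Fintype.card (Fin (d + 1))) * Sdef :=
    calc O2 ≤ 1 * Sdef * (144 * π ^ 3 + 32 * π ^ 3 * Fintype.card (Fin (d + 1))) := mul_le_mul_of_nonneg_right (mul_le_mul (pow_le_one₀ (inv_nonneg.mpr hWpos.le) hw1) (hnwε.trans hεS) (inv_nonneg.mpr (mul_nonneg hnr.le hWpos.le)) zero_le_one) (by positivity)
      _ = (144 * π ^ 3 + 32 * π ^ 3 * Fintype.card (Fin (d + 1))) * Sdef := by ring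
  have hss : sS ≤ 1 * Sdef := (by show sS ≤ 1 * (εk + (o + sS)); linarith only [hεk0, ho0]); have hsm₀ : Cs * εk ≤ Cs * Sdef := mul_le_mul_of_nonneg_left hεS hCs.le
  have hsRN : RNK ≤ KRN * Sdef := by
    have h1 : (π * (d + 1) / (L ^ mv : ℕ) * (Real.exp 1 * (δs / 2))⁻¹ + 2 * (π * (d + 1) / (L ^ mv : ℕ))) * (4 / 3 * a₀ * ((L : ℝ) ^ kk) ^ (-(1 / 4 : ℝ))) ≤ (π * (d + 1) * E' + 2 * (π * (d + 1))) * (4 / 3 * a₀ * Sdef) := mul_le_mul hLRb (mul_le_mul_of_nonneg_left hεS (by positivity)) (by positivity) (by positivity)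
    have h2 : 2 * (π * (d + 1) / (((L ^ kk : ℕ) : ℝ) * (L ^ mv : ℕ))) * (|aK a₀ (L : ℝ) kk| + |aK a₀ (L : ℝ) (r + kk)|) ≤ 2 * (π * (d + 1) * Sdef) * (2 * a₀) := mul_le_mul (mul_le_mul_of_nonneg_left hsoχ zero_le_two) haKabs (by positivity) (by positivity)
    calc RNK ≤ (π * (d + 1) * E' + 2 * (π * (d + 1))) * (4 / 3 * a₀ * Sdef) + 2 * (π * (d + 1) * Sdef) * (2 * a₀) := add_le_add h1 h2
      _ = ((π * (d + 1) * E' + 2 * (π * (d + 1))) * (4 / 3 * a₀) + 2 * (π * (d + 1)) * (2 * a₀)) * Sdef := by ring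
  have hsDη0 : (π / W) / η⁻¹ ≤ π * Sdef := (by rw [hηinv, div_eq_mul_inv]; exact mul_le_mul (div_le_self pi_pos.le hW1) (hnε.trans hεS) (inv_nonneg.mpr hnr.le) pi_pos.le); have hsDη1 : (π / W) / η'⁻¹ ≤ π * Sdef := (by rw [hη'inv, div_eq_mul_inv]; exact mul_le_mul (div_le_self pi_pos.le hW1) (hn'ε.trans hεS) (inv_nonneg.mpr hnr'.le) pi_pos.le); have hDη00 : 0 ≤ (π / W) / η⁻¹ := div_nonneg (div_nonneg pi_pos.le hWpos.le) (inv_nonneg.mpr hη0); have hDη10 : 0 ≤ (π / W) / η'⁻¹ := div_nonneg (div_nonneg pi_pos.le hWpos.le) (inv_nonneg.mpr hη'0); have hsos : π * (d + 1) / (((L ^ kk : ℕ) : ℝ) * W) + (π / W) / η⁻¹ ≤ (π * (d + 1) + π) * Sdef := (add_le_add hsoχ hsDη0).trans_eq (by ring); have hso0 : (π / W) / η⁻¹ + (π / W) / η'⁻¹ ≤ (π + π) * Sdef := (add_le_add hsDη0 hsDη1).trans_eq (by ring)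
  have hof : ∀ x : ℝ, 0 ≤ x → x ≤ o → x ≤ 1 * Sdef := fun x hx hxo => by show x ≤ 1 * (εk + (o + sS)); linarith only [hxo, hεk0, hsS0]
  have hle9 : oC ≤ o ∧ oA ≤ o ∧ og ≤ o ∧ oN ≤ o ∧ rfa ≤ o ∧ oR ≤ o ∧ oR' ≤ o ∧ oB ≤ o ∧ od ≤ o := (by refine ⟨?_, ?_, ?_, ?_, ?_, ?_, ?_, ?_, ?_⟩ <;> linarith); have hKc : ∀ (y y' : Tor (cvM d L mv kk hL)), 0 ≤ Cs * ((L : ℝ) ^ kk) ^ (-(1 / 4 : ℝ)) * Real.exp (-(δs * tdistT (cvM d L mv kk hL) y y')) := fun y y' => mul_nonneg (mul_nonneg hCs.le hεk0) (Real.exp_nonneg _); have hrateK : ∀ (y y' : Tor (cvM d L mv kk hL)), Cs * ((L : ℝ) ^ kk) ^ (-(1 / 4 : ℝ)) * Real.exp (-(δs * tdistT (cvM d L mv kk hL) y y')) ≤ (Cs * εk) * Real.exp (-(δT * (unitTorusGeo L kk (cvM d L mv kk hL)).dist y y')) := fun y y' => by rw [unitTorusGeo_dist]; exact mul_le_mul_of_nonneg_left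 (Real.exp_le_exp.mpr (by rw [hδTdef]; exact neg_le_neg (mul_le_mul_of_nonneg_right (by linarith only [hδs0]) (tdistT_nonneg (cvM d L mv kk hL) y y')))) (mul_nonneg hCs.le hεk0)
  have hrateKc : ∀ (k : Fin (d + 1) → ZMod (2 * L)) (y y' : Tor (cvM d L mv kk hL)), ind (g := unitTorusGeo L kk (cvM d L mv kk hL)) (cvSk d L mv kk hL k) y * ind (g := unitTorusGeo L kk (cvM d L mv kk hL)) (cvSk d L mv kk hL k) y' * (Cs * ((L : ℝ) ^ kk) ^ (-(1 / 4 : ℝ)) * Real.exp (-(δs * tdistT (cvM d L mv kk hL) y y'))) ≤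
      ind (g := unitTorusGeo L kk (cvM d L mv kk hL)) (cvSk d L mv kk hL k) y * ind (g := unitTorusGeo L kk (cvM d L mv kk hL)) (cvSk d L mv kk hL k) y' * ((Cs * εk) * Real.exp (-(δT * (unitTorusGeo L kk (cvM d L mv kk hL)).dist y y'))) :=
    fun k y y' => mul_le_mul_of_nonneg_left (hrateK y y') (mul_nonneg (ind_nonneg _ _) (ind_nonneg _ _))
  have hfit₁ : ∀ k, ∀ μ p', |((fun p' : ScX' d L mv kk r hL × ι => (scBump' d L mv kk r hL k) p'.1) ∘ (liftEquiv (scShift' d L mv kk r hL μ) ι)) p' - ((fun p : ScX d L mv kk hL × ι => (scBump d L mv kk hL k) p.1) ∘ (liftEquiv (scShift d L mv kk hL μ) ι)) (liftMap (kingPr L kk r (cvM d L mv kk hL)) ι p')| ≤ (2 * (π * (d + 1) / (((L ^ kk : ℕ) : ℝ) * W))) := fun k μ p' => abs_scBump'_scShift'_sub_le ι hM hw k μ p'; have hfit₁b : ∀ k, ∀ μ p', |((fun p' : ScX' d L mv kk r hL × ι => (scBump' d L mv kk r hL k) p'.1) ∘ (liftEquiv (scShift' d L mv kk r hL μ) ι).symm)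 p' - ((fun p : ScX d L mv kk hL × ι => (scBump d L mv kk hL k) p.1) ∘ (liftEquiv (scShift d L mv kk hL μ) ι).symm) (liftMap (kingPr L kk r (cvM d L mv kk hL)) ι p')| ≤ (2 * (π * (d + 1) / (((L ^ kk : ℕ) : ℝ) * W))) := fun k μ p' => abs_scBump'_scShift'_symm_sub_le ι hM hw k μ p'
  have hfit₂ : ∀ k, ∀ μ p', |fgrad η'⁻¹ (liftEquiv (scShift' d L mv kk r hL μ) ι) (fun p' : ScX' d L mv kk r hL × ι => (scBump' d L mv kk r hL k) p'.1) p' - fgrad η⁻¹ (liftEquiv (scShift d L mv kk hL μ) ι) (fun p : ScX d L mv kk hL × ι => (scBump d L mv kk hL k) p.1) (liftMap (kingPr L kk r (cvM d L mv kk hL)) ι p')| ≤ ((W)⁻¹ * (((L ^ kk : ℕ) : ℝ) * W)⁻¹ * (32 * π ^ 4 + π ^ 2 * (d + 1))) := (by rw [hηinv, hη'inv]; exact fun k μ p' => abs_fgrad_scBump'_sub_le ι hM hw hL4 k μ p')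
  have hfit₂b : ∀ k, ∀ μ p', |bgrad η'⁻¹ (liftEquiv (scShift' d L mv kk r hL μ) ι) (fun p' : ScX' d L mv kk r hL × ι => (scBump' d L mv kk r hL k) p'.1) p' - bgrad η⁻¹ (liftEquiv (scShift d L mv kk hL μ) ι) (fun p : ScX d L mv kk hL × ι => (scBump d L mv kk hL k) p.1) (liftMap (kingPr L kk r (cvM d L mv kk hL)) ι p')| ≤ ((W)⁻¹ * (((L ^ kk : ℕ) : ℝ) * W)⁻¹ * (32 * π ^ 4 + π ^ 2 * (d + 1))) := (by rw [hηinv, hη'inv]; exact fun k μ p' => abs_bgrad_scBump'_sub_le ι hM hw hL4 k μ p'); have hfitχ : ∀ k, ∀ x', |(scBump' d L mv kk r hL k) x' - (scBump d L mv kk hL k) ((kingPr L kk r (cvM d L mv kk hL)) x')| ≤ (π * (d + 1) / (((L ^ kk : ℕ) : ℝ) * W)) := fun k x' => abs_scBump'_sub_scBump_kingPr_le hM hw k x'; have hχπ : ∀ k x', scChi' d L mv kk r hL k x' = scChi d L mv kk hL k ((kingPr L kk r (cvM d L mv kk hL)) x') := fun k x' => scChi'_eq_scChi_kingPr (d :=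 d) (hL := hL) k x'
  have hχv : ∀ k (x : ScX d L mv kk hL), scChi d L mv kk hL k x ≠ 0 → scChi d L mv kk hL k x = 1 := fun k x h => by
    by_cases hm : blockOf (L ^ kk) (cvM d L mv kk hL) x ∈ cubeBlocks (cvM d L mv kk hL) (coverCorner (cvM d L mv kk hL) (L ^ mv) L (2 * L ^ mv) k) (6 * L ^ mv + 1)
    · show chiCube (cvM d L mv kk hL) (L ^ kk) (coverCorner (cvM d L mv kk hL) (L ^ mv) L (2 * L ^ mv) k) (6 * L ^ mv + 1) (x, 0) = 1
      unfold TwoGrid.chiCube; exact if_pos hm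
    · exact (h (chiCube_of_not_mem (b := (x, (0 : Fin (d + 1)))) hm)).elim
  have hχv' : ∀ k (x : ScX' d L mv kk r hL), scChi' d L mv kk r hL k x ≠ 0 → scChi' d L mv kk r hL k x = 1 := fun k x h => by
    by_cases hm : blockOf (L ^ r * L ^ kk) (cvM d L mv kk hL) x ∈ cubeBlocks (cvM d L mv kk hL) (coverCorner (cvM d L mv kk hL) (L ^ mv) L (2 * L ^ mv) k) (6 * L ^ mv + 1)
    · show chiCube (cvM d L mv kk hL) (L ^ r * L ^ kk) (coverCorner (cvM d L mv kk hL) (L ^ mv) L (2 * L ^ mv) k) (6 * L ^ mv + 1) (x, 0) = 1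
      unfold TwoGrid.chiCube; exact if_pos hm
    · exact (h (chiCube_of_not_mem (b := (x, (0 : Fin (d + 1)))) hm)).elim
  have hχχ : ∀ k, mulOp (fun p : ScX d L mv kk hL × ι => scChi d L mv kk hL k p.1) ∘ₗ mulOp (fun p : ScX d L mv kk hL × ι => scChi d L mv kk hL k p.1) = mulOp (fun p : ScX d L mv kk hL × ι => scChi d L mv kk hL k p.1) := fun k => mulOp_comp_mulOp_of_support_left fun p hp => hχv k p.1 hp; have hχχ' : ∀ k, mulOp (fun p : ScX' d L mv kk r hL × ι => scChi' d L mv kk r hL k p.1) ∘ₗ mulOp (fun p : ScX' d L mv kk r hL × ι => scChi' d L mv kk r hL k p.1) = mulOp (fun p : ScX' d L mv kk r hL × ι => scChi' d L mv kk r hL k p.1) := fun k => mulOp_comp_mulOp_of_support_left fun p hp => hχv' k p.1 hp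
  have hχtχ : ∀ k (p : ScX d L mv kk hL × ι), scBump d L mv kk hL k p.1 ≠ 0 → scChi d L mv kk hL k p.1 = 1 := fun k p hp => by
    have e1 := congrFun (LinearMap.congr_fun (hsub k) (fun _ => (1 : ℝ))) p
    simp only [LinearMap.comp_apply, mulOp_apply, mul_one] at e1
    exact mul_left_cancel₀ hp (by rw [e1, mul_one])
  have hψoχt : ∀ k, mulOp (fun p : ScX d L mv kk hL × ι => scPsi d L mv kk hL k p.1) ∘ₗ mulOp (fun p : ScX d L mv kk hL × ι => scBump d L mv kk hL k p.1) = mulOp (fun p : ScX d L mv kk hL × ι => scBump d L mv kk hL k p.1) := fun k => mulOp_comp_mulOp_of_support_left fun p hp => (scPsi_near_scChi hM hmar₂ hfitm₂ hS0 0 k (by rw [hχtχ k p hp]; exact one_ne_zero)).1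
  have hψ'χ' : ∀ k x', scPsi' d L mv kk r hL k x' * scChi' d L mv kk r hL k x' = scChi' d L mv kk r hL k x' := fun k x' => by
    by_cases h0 : scChi' d L mv kk r hL k x' = 0
    · rw [h0, mul_zero]
    · rw [(scPsi'_near_scChi' hM hmar₂ hfitm₂ hS0 0 k h0).1, one_mul]
  have hhχ' : ∀ (k : Fin (d + 1) → ZMod (2 * L)) (x : ScX' d L mv kk r hL), scH' d L mv kk r hL k x ≠ 0 → scChi' d L mv kk r hL k x ≠ 0 := fun k x hx => by
    have h := chiCube_box_eq_one_of_coverH_ne_zero (n := L ^ r * L ^ kk) hM hw hS6 0 k (x := (x, (0 : Fin (d + 1)))) (Or.inl rfl) hx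
    rw [show scChi' d L mv kk r hL k x = chiCube (cvM d L mv kk hL) (L ^ r * L ^ kk) (coverCorner (cvM d L mv kk hL) (L ^ mv) L (2 * L ^ mv) k) (6 * L ^ mv + 1) (x, 0) from rfl, h]
    exact one_ne_zero
  have hblk' : liftBlk (scBlk' d L mv kk r hL) ι = liftBlk (scBlk d L mv kk hL ∘ kingPr L kk r (cvM d L mv kk hL)) ι := funext fun p => (blockOf_kingPr (cvM d L mv kk hL) L kk r p.1).symm; have hcutT' := fun k => hasMaj_src_tgt_congr hblk' (hcutf9 k); have hcutFT' := fun k μ => hasMaj_src_tgt_congr hblk' (hcutFf9 k μ); have hcutBT' := fun k μ => hasMaj_src_tgt_congr hblk' (hcutBf9 k μ); have hTfrT' := fun k μ => hasMaj_src_tgt_congr hblk' (hTfrf9 k μ); have hTbrT' := fun k μ => hasMaj_src_tgt_congr hblk' (hTbrf9 k μ); have hKNT' := fun k => hasMaj_src_tgt_congr hblk' (hKNf9 k); have hDcut := fun k => (hasMaj_idef_cut_scCubeP ι hM hm₁ hfitI hmar₂ hfitm₂ hS0 hKc hDGs k).mono (hrateKc k); have hDcutF := fun k μ => (hasMaj_idef_cutF_scCubeP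 ι hM hm₁ hfitI hmar₂ hfitm₂ hS0 hKc μ (hDGFs) k).mono (hrateKc k)
  have hDcutB := fun k μ => (hasMaj_idef_cutB_scCubeP ι hM hm₁ hfitI hmar₂ hfitm₂ hS0 hKc μ (hDGBs) k).mono (hrateKc k); have hDTb := fun k μ => (hasMaj_idef_scT_bgrad_plain ι hKc μ hDGAs k).mono (hrateK); have hITb := fun k μ => (hasMaj_idef_cut_scT_bgrad ι hKc μ hDGAs k).mono (hrateKc k); have hDTf := fun k μ => (hasMaj_idef_scT_fgrad_plain ι hKc μ (by rw [inv_inv, inv_inv]; exact H7s μ) k).mono (hrateK); have hITf := fun k μ => (hasMaj_idef_cut_scT_fgrad ι hKc μ (by rw [inv_inv, inv_inv]; exact H7s μ) k).mono (hrateKc k); have hh1L : ∀ k, ∀ μ p, |fgrad η⁻¹ (liftEquiv (scShift d L mv kk hL μ) ι) (fun p : ScX d L mv kk hL × ι => scH d L mv kk hL k p.1) p| ≤ (π / W) := (by rw [hηinv]; exact fun k μ p => (abs_fgrad_hcube_le (2 * L) (fun ν (p : ScX d L mv kk hL × ι) => scXi d L mv kk hL ν p.1) (fun μ => liftEquiv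 (scShift d L mv kk hL μ) ι) hK0 hξS _ k μ p).trans hsW.le)
  have hh1bL : ∀ k, ∀ μ p, |bgrad η⁻¹ (liftEquiv (scShift d L mv kk hL μ) ι) (fun p : ScX d L mv kk hL × ι => scH d L mv kk hL k p.1) p| ≤ (π / W) := (by rw [hηinv]; exact fun k μ p => (abs_bgrad_hcube_le (2 * L) (fun ν (p : ScX d L mv kk hL × ι) => scXi d L mv kk hL ν p.1) (fun μ => liftEquiv (scShift d L mv kk hL μ) ι) hK0 hξS _ k μ p).trans hsW.le); have hh1L' : ∀ k, ∀ μ p', |fgrad η'⁻¹ (liftEquiv (scShift' d L mv kk r hL μ) ι) (fun p : ScX' d L mv kk r hL × ι => scH' d L mv kk r hL k p.1) p'| ≤ (π / W) := (by rw [hη'inv]; exact fun k μ p => (abs_fgrad_hcube_le (2 * L) (fun ν (p : ScX' d L mv kk r hL × ι) => scXi' d L mv kk r hL ν p.1) (fun μ => liftEquiv (scShift' d L mv kk r hL μ) ι) hK0 hξS' _ k μ p).trans hsW'.le)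
  have hh1bL' : ∀ k, ∀ μ p', |bgrad η'⁻¹ (liftEquiv (scShift' d L mv kk r hL μ) ι) (fun p : ScX' d L mv kk r hL × ι => scH' d L mv kk r hL k p.1) p'| ≤ (π / W) := (by rw [hη'inv]; exact fun k μ p => (abs_bgrad_hcube_le (2 * L) (fun ν (p : ScX' d L mv kk r hL × ι) => scXi' d L mv kk r hL ν p.1) (fun μ => liftEquiv (scShift' d L mv kk r hL μ) ι) hK0 hξS' _ k μ p).trans hsW'.le); have hh2L' : ∀ k, ∀ μ p', |fgradAdj η'⁻¹ (liftEquiv (scShift' d L mv kk r hL μ) ι) (fgrad η'⁻¹ (liftEquiv (scShift' d L mv kk r hL μ) ι) (fun p : ScX' d L mv kk r hL × ι => scH' d L mv kk r hL k p.1)) p'| ≤ (32 * π ^ 2 / W ^ 2) := (by rw [hη'inv]; exact fun k μ p => (abs_fgradAdj_fgrad_hcube_le (2 * L) (fun ν (p : ScX' d L mv kk r hL × ι) => scXi' d L mv kk r hL ν p.1) (fun μ => liftEquiv (scShift' d L mv kk r hL μ) ι) hK2 hξS' hs0f hs1f _ k μ p).trans hsW2'.le)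
  have hf1L : ∀ k, ∀ μ p', |fgrad η'⁻¹ (liftEquiv (scShift' d L mv kk r hL μ) ι) (fun p : ScX' d L mv kk r hL × ι => scH' d L mv kk r hL k p.1) p' - fgrad η⁻¹ (liftEquiv (scShift d L mv kk hL μ) ι) (fun p : ScX d L mv kk hL × ι => scH d L mv kk hL k p.1) (liftMap (kingPr L kk r (cvM d L mv kk hL)) ι p')| ≤ O1 := (by rw [hηinv, hη'inv]; exact fun k μ p' => abs_fgrad_scH'_sub_le ι hM hw h3 k μ p'); have hf1bL : ∀ k, ∀ μ p', |bgrad η'⁻¹ (liftEquiv (scShift' d L mv kk r hL μ) ι) (fun p : ScX' d L mv kk r hL × ι => scH' d L mv kk r hL k p.1) p' - bgrad η⁻¹ (liftEquiv (scShift d L mv kk hL μ) ι) (fun p : ScX d L mv kk hL × ι => scH d L mv kk hL k p.1) (liftMap (kingPr L kk r (cvM d L mv kk hL)) ι p')| ≤ O1 := (by rw [hηinv, hη'inv]; exact fun k μ p' => abs_bgrad_scH'_sub_le ι hM hw h3 k μ p')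
  have hf2L : ∀ k, ∀ μ p', |fgradAdj η'⁻¹ (liftEquiv (scShift' d L mv kk r hL μ) ι) (fgrad η'⁻¹ (liftEquiv (scShift' d L mv kk r hL μ) ι) (fun p : ScX' d L mv kk r hL × ι => scH' d L mv kk r hL k p.1)) p' - fgradAdj η⁻¹ (liftEquiv (scShift d L mv kk hL μ) ι) (fgrad η⁻¹ (liftEquiv (scShift d L mv kk hL μ) ι) (fun p : ScX d L mv kk hL × ι => scH d L mv kk hL k p.1)) (liftMap (kingPr L kk r (cvM d L mv kk hL)) ι p')| ≤ O2 := (by rw [hηinv, hη'inv]; exact fun k μ p' => abs_fgradAdj_fgrad_scH'_sub_le ι hM hw h3 k μ p')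
  have hDKN : ∀ k, HasMaj (ScNorm d L mv kk hL ι) (BlockNorm.ofBlocks (unitTorusGeo L kk (cvM d L mv kk hL)) (liftBlk (scBlk d L mv kk hL ∘ kingPr L kk r (cvM d L mv kk hL)) ι)) (idef (pull (liftMap (kingPr L kk r (cvM d L mv kk hL)) ι)) (pull (liftMap (kingPr L kk r (cvM d L mv kk hL)) ι)) (commOp (scQQ' d L mv kk r hL (aK a₀ (L : ℝ) (r + kk) * (((L ^ r * L ^ kk : ℕ) : ℝ)) ^ (d + 1)) ι) (fun p : ScX' d L mv kk r hL × ι => scH' d L mv kk r hL k p.1)) (commOp (scQQ d L mv kk hL (aK a₀ (L : ℝ) kk * (((L ^ kk : ℕ) : ℝ)) ^ (d + 1)) ι) (fun p : ScX d L mv kk hL × ι => scH d L mv kk hL k p.1))) (fun y y' => RNK * Real.exp (-((δs - δs / 2) * (unitTorusGeo L kk (cvM d L mv kk hL)).dist y y'))) := fun k => hasMaj_idef_commOp_scQQ_scH_king ι hM hw hL2R hk ha₀ (γ := (1 / 4 : ℝ)) (by norm_num) k δs (ε := δs / 2) (by positivity)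

  have hDKN2 := fun k => (hDKN k).mono fun y y' => le_of_eq (by rw [show δs - δs / 2 = δs / 2 from by ring])
  have hhD : ∀ k, ∀ μ (p : ScX d L mv kk hL × ι), |(fgrad η⁻¹ (liftEquiv ((scShift d L mv kk hL) μ) ι) (fun p : ScX d L mv kk hL × ι => (scH d L mv kk hL k) p.1) ∘ ⇑(liftEquiv ((scShift d L mv kk hL) μ) ι).symm) p| ≤ (π / W) := fun k μ p => by
    simp only [Function.comp_apply]; exact hh1L k μ _
  have hhB : ∀ k, ∀ μ (p : ScX d L mv kk hL × ι), |(bgrad η⁻¹ (liftEquiv ((scShift d L mv kk hL) μ) ι) (fun p : ScX d L mv kk hL × ι => (scH d L mv kk hL k) p.1) ∘ ⇑(liftEquiv ((scShift d L mv kk hL) μ) ι)) p| ≤ (π / W) := fun k μ p => by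
    simp only [Function.comp_apply]; exact hh1bL k μ _
  have efb : ∀ {Y : Type} (n : ℝ) (E : Y ≃ Y) (f : Y → ℝ) (p : Y), (fgrad n E f ∘ ⇑E.symm) p = bgrad n E f p := fun n E f p => by
    simp only [Function.comp_apply, fgrad_apply, bgrad_apply, Equiv.apply_symm_apply]
  have ebf : ∀ {Y : Type} (n : ℝ) (E : Y ≃ Y) (f : Y → ℝ) (p : Y), (bgrad n E f ∘ ⇑E) p = fgrad n E f p := fun n E f p => by
    simp only [Function.comp_apply, fgrad_apply, bgrad_apply, Equiv.symm_apply_apply]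
  have ebfF : ∀ {Y : Type} (n : ℝ) (E : Y ≃ Y) (f : Y → ℝ), bgrad n E f ∘ ⇑E = fgrad n E f := fun n E f => funext (ebf n E f)
  have eab : ∀ {Y : Type} (n : ℝ) (E : Y ≃ Y) (f : Y → ℝ) (p : Y), fgradAdj n E f p = -bgrad n E f p := fun n E f p => by
    simp only [fgradAdj_apply, bgrad_apply]; ring
  have hfD : ∀ k, ∀ μ (p' : ScX' d L mv kk r hL × ι), |(fgrad η'⁻¹ (liftEquiv ((scShift' d L mv kk r hL) μ) ι) (fun p : ScX' d L mv kk r hL × ι => (scH' d L mv kk r hL k) p.1) ∘ ⇑(liftEquiv ((scShift' d L mv kk r hL) μ) ι).symm) p' - (fgrad η⁻¹ (liftEquiv ((scShift d L mv kk hL) μ) ι) (fun p : ScX d L mv kk hL × ι => (scH d L mv kk hL k) p.1) ∘ ⇑(liftEquiv ((scShift d L mv kk hL) μ) ι).symm) (liftMap (kingPr L kk r (cvM d L mv kk hL)) ι p')| ≤ O1 := fun k μ p' => by rw [efb, efb]; exact hf1bL k μ p'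
  have hfB : ∀ k, ∀ μ (p' : ScX' d L mv kk r hL × ι), |(bgrad η'⁻¹ (liftEquiv ((scShift' d L mv kk r hL) μ) ι) (fun p : ScX' d L mv kk r hL × ι => (scH' d L mv kk r hL k) p.1) ∘ ⇑(liftEquiv ((scShift' d L mv kk r hL) μ) ι)) p' - (bgrad η⁻¹ (liftEquiv ((scShift d L mv kk hL) μ) ι) (fun p : ScX d L mv kk hL × ι => (scH d L mv kk hL k) p.1) ∘ ⇑(liftEquiv ((scShift d L mv kk hL) μ) ι)) (liftMap (kingPr L kk r (cvM d L mv kk hL)) ι p')| ≤ O1 := fun k μ p' => by rw [ebf, ebf]; exact hf1L k μ p'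
  have hf2f : ∀ k, ∀ μ (p' : ScX' d L mv kk r hL × ι), |(fgrad η'⁻¹ (liftEquiv ((scShift' d L mv kk r hL) μ) ι) (fgrad η'⁻¹ (liftEquiv ((scShift' d L mv kk r hL) μ) ι) (fun p : ScX' d L mv kk r hL × ι => (scH' d L mv kk r hL k) p.1)) ∘ ⇑(liftEquiv ((scShift' d L mv kk r hL) μ) ι).symm) p' - (fgrad η⁻¹ (liftEquiv ((scShift d L mv kk hL) μ) ι) (fgrad η⁻¹ (liftEquiv ((scShift d L mv kk hL) μ) ι) (fun p : ScX d L mv kk hL × ι => (scH d L mv kk hL k) p.1)) ∘ ⇑(liftEquiv ((scShift d L mv kk hL) μ) ι).symm) (liftMap (kingPr L kk r (cvM d L mv kk hL)) ι p')| ≤ O2 :=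
    fun k μ p' => by
      have h := hf2L k μ p'; rw [eab, eab, ← abs_neg] at h; rw [efb, efb]; convert h using 2; ring
  have hf2b : ∀ k, ∀ μ (p' : ScX' d L mv kk r hL × ι), |bgrad η'⁻¹ (liftEquiv ((scShift' d L mv kk r hL) μ) ι) (bgrad η'⁻¹ (liftEquiv ((scShift' d L mv kk r hL) μ) ι) (fun p : ScX' d L mv kk r hL × ι => (scH' d L mv kk r hL k) p.1) ∘ ⇑(liftEquiv ((scShift' d L mv kk r hL) μ) ι)) p' - bgrad η⁻¹ (liftEquiv ((scShift d L mv kk hL) μ) ι) (bgrad η⁻¹ (liftEquiv ((scShift d L mv kk hL) μ) ι) (fun p : ScX d L mv kk hL × ι => (scH d L mv kk hL k) p.1) ∘ ⇑(liftEquiv ((scShift d L mv kk hL) μ) ι)) (liftMap (kingPr L kk r (cvM d L mv kk hL)) ι p')| ≤ O2 :=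
    fun k μ p' => by
      have h := hf2L k μ p'; rw [eab, eab, ← abs_neg] at h; rw [ebfF, ebfF]; convert h using 2; ring
  have hf1 : ∀ k, ∀ μ (x' : ScX' d L mv kk r hL), |fgrad η'⁻¹ ((scShift' d L mv kk r hL) μ) (scH' d L mv kk r hL k) x' - fgrad η⁻¹ ((scShift d L mv kk hL) μ) (scH d L mv kk hL k) ((kingPr L kk r (cvM d L mv kk hL)) x')| ≤ O1 := fun k μ x' => by rw [hηinv, hη'inv]; simpa only [fgrad_apply, liftEquiv_apply, liftMap] using abs_fgrad_scH'_sub_le PUnit hM hw h3 k μ (x', PUnit.unit)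
  have hf1b : ∀ k, ∀ μ (x' : ScX' d L mv kk r hL), |bgrad η'⁻¹ ((scShift' d L mv kk r hL) μ) (scH' d L mv kk r hL k) x' - bgrad η⁻¹ ((scShift d L mv kk hL) μ) (scH d L mv kk hL k) ((kingPr L kk r (cvM d L mv kk hL)) x')| ≤ O1 := fun k μ x' => by rw [hηinv, hη'inv]; simpa only [bgrad_apply, liftEquiv_symm_apply, liftMap] using abs_bgrad_scH'_sub_le PUnit hM hw h3 k μ (x', PUnit.unit)
  have hf2 := hf2L
  have hgq : ∀ {Y : Type} (n : ℝ) (hn0 : 0 < n) (E : Y ≃ Y) (f : Y → ℝ) (c : ℝ) (x : Y), |fgrad n E f x| ≤ c → |f (E x) - f x| ≤ c / n := fun n hn0 E f c x h => by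
    rw [fgrad_apply, abs_mul, abs_of_pos hn0] at h; rw [le_div_iff₀ hn0, mul_comm]; exact h
  have hgqb : ∀ {Y : Type} (n : ℝ) (hn0 : 0 < n) (E : Y ≃ Y) (f : Y → ℝ) (c : ℝ) (x : Y), |bgrad n E f x| ≤ c → |f x - f (E.symm x)| ≤ c / n := fun n hn0 E f c x h => by
    rw [bgrad_apply, abs_mul, abs_of_pos hn0] at h; rw [le_div_iff₀ hn0, mul_comm]; exact h
  have hηi0 : 0 < η⁻¹ := (by rw [hηinv]; exact hnr); have hη'i0 : 0 < η'⁻¹ := (by rw [hη'inv]; exact hnr')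
  have hf0 : ∀ k, ∀ μ (x' : ScX' d L mv kk r hL), |((scH' d L mv kk r hL k) ((scShift' d L mv kk r hL) μ x') - (scH' d L mv kk r hL k) x') - ((scH d L mv kk hL k) ((scShift d L mv kk hL) μ ((kingPr L kk r (cvM d L mv kk hL)) x')) - (scH d L mv kk hL k) ((kingPr L kk r (cvM d L mv kk hL)) x'))| ≤ (π / W) / η⁻¹ + (π / W) / η'⁻¹ :=
    fun k μ x' => by
      have a := hgq _ hη'i0 _ _ _ x' (hh1f9 k μ x'); have b := hgq _ hηi0 _ _ _ ((kingPr L kk r (cvM d L mv kk hL)) x') (hh1 k μ _)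
      calc _ ≤ |(scH' d L mv kk r hL k) ((scShift' d L mv kk r hL) μ x') - (scH' d L mv kk r hL k) x'| + |(scH d L mv kk hL k) ((scShift d L mv kk hL) μ ((kingPr L kk r (cvM d L mv kk hL)) x')) - (scH d L mv kk hL k) ((kingPr L kk r (cvM d L mv kk hL)) x')| := abs_sub _ _
        _ ≤ (π / W) / η'⁻¹ + (π / W) / η⁻¹ := add_le_add a b
        _ = _ := add_comm _ _
  have hf0b : ∀ k, ∀ μ (x' : ScX' d L mv kk r hL), |((scH' d L mv kk r hL k) x' - (scH' d L mv kk r hL k) (((scShift' d L mv kk r hL) μ).symm x')) - ((scH d L mv kk hL k) ((kingPr L kk r (cvM d L mv kk hL)) x') - (scH d L mv kk hL k) (((scShift d L mv kk hL) μ).symm ((kingPr L kk r (cvM d L mv kk hL)) x')))| ≤ (π / W) / η⁻¹ + (π / W) / η'⁻¹ :=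
    fun k μ x' => by
      have a := hgqb _ hη'i0 _ _ _ x' (hh1bf9 k μ x'); have b := hgqb _ hηi0 _ _ _ ((kingPr L kk r (cvM d L mv kk hL)) x') (hh1b k μ _)
      calc _ ≤ |(scH' d L mv kk r hL k) x' - (scH' d L mv kk r hL k) (((scShift' d L mv kk r hL) μ).symm x')| + |(scH d L mv kk hL k) ((kingPr L kk r (cvM d L mv kk hL)) x') - (scH d L mv kk hL k) (((scShift d L mv kk hL) μ).symm ((kingPr L kk r (cvM d L mv kk hL)) x'))| := abs_sub _ _
        _ ≤ (π / W) / η'⁻¹ + (π / W) / η⁻¹ := add_le_add a b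
        _ = _ := add_comm _ _
  have hfit : ∀ k, ∀ (x' : ScX' d L mv kk r hL), |(scH' d L mv kk r hL k) x' - (scH d L mv kk hL k) ((kingPr L kk r (cvM d L mv kk hL)) x')| ≤ (π * (d + 1) / (((L ^ kk : ℕ) : ℝ) * W)) := fun k x' => abs_scH'_sub_scH_kingPr_le PUnit hM hw k (x', PUnit.unit)
  have hcross : ∀ x' : ScX' d L mv kk r hL, kingPr L kk r (cvM d L mv kk hL) ((scShift' d L mv kk r hL) ν x') = kingPr L kk r (cvM d L mv kk hL) x' ∨ kingPr L kk r (cvM d L mv kk hL) ((scShift' d L mv kk r hL) ν x') = (scShift d L mv kk hL) ν (kingPr L kk r (cvM d L mv kk hL) x') := fun x' => by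
    have h := kingPr_add_unitVec (cvM d L mv kk hL) L kk r x' ν
    show kingPr L kk r (cvM d L mv kk hL) (x' + unitVec (fine (L ^ r * L ^ kk) (cvM d L mv kk hL)) ν) = kingPr L kk r (cvM d L mv kk hL) x' ∨ kingPr L kk r (cvM d L mv kk hL) (x' + unitVec (fine (L ^ r * L ^ kk) (cvM d L mv kk hL)) ν) = kingPr L kk r (cvM d L mv kk hL) x' + unitVec (fine (L ^ kk) (cvM d L mv kk hL)) ν
    rw [h]; split_ifs
    · exact Or.inr rfl
    · exact Or.inl rfl
  have hfits : ∀ k (x' : ScX' d L mv kk r hL), |scH' d L mv kk r hL k ((scShift' d L mv kk r hL) ν x') - scH d L mv kk hL k ((scShift d L mv kk hL) ν ((kingPr L kk r (cvM d L mv kk hL)) x'))| ≤ π * (d + 1) / (((L ^ kk : ℕ) : ℝ) * W) + (π / W) / η⁻¹ := fun k x' => abs_shift_fit_of_cross (ι := PUnit) (kingPr L kk r (cvM d L mv kk hL)) ((scShift d L mv kk hL) ν) ((scShift' d L mv kk r hL) ν) hηi0 (fun q => hfit k q.1) (fun q => (by simpa only [fgrad_apply] using hh1 k ν q.1)) hcross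 (x', PUnit.unit); have hN : ∀ b, ∑ k, ind (g := unitTorusGeo L kk (cvM d L mv kk hL)) (cvSk d L mv kk hL k) b ≤ Nov := fun y => sum_ind_cubeBlocks_le (M := cvM d L mv kk hL) (w := L ^ mv) (q := L) (m₀ := coverMargin L mv) L kk y
  have hTk : ∀ k, (ctauS (cvM d L mv kk hL) L kk r (fun μ x' => coordMat e (ContinuousLinearMap.mulLeftRight ℝ (Matrix m m ℂ) (U' μ x') (U' μ x')ᴴ))) = mmulOp (fun x' => (coordMat e (ContinuousLinearMap.mulLeftRight ℝ (Matrix m m ℂ) (u' k x') (u' k x')ᴴ))ᵀ) ∘ₗ (mmulOp (fun x' => (kingStairT (cvM d L mv kk hL) (L ^ r * L ^ kk) (L ^ r) (fun μ b => coordMat e (ContinuousLinearMap.mulLeftRight ℝ (Matrix m m ℂ) (u' k b.1 * U' μ b.1 * (u' k (b.1 + unitVec (fine (L ^ r * L ^ kk) (cvM d L mv kk hL)) μ))ᴴ) (u' k b.1 * U' μ b.1 * (u' k (b.1 + unitVec (fine (L ^ r * L ^ kk) (cvM d L mv kk hL)) μ))ᴴ)ᴴ)) (x', 0))ᵀ)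 ∘ₗ pull (liftMap (kingPr L kk r (cvM d L mv kk hL)) ι)) ∘ₗ mmulOp (fun x => coordMat e (ContinuousLinearMap.mulLeftRight ℝ (Matrix m m ℂ) (u' k (kingSec (cvM d L mv kk hL) L kk r x)) (u' k (kingSec (cvM d L mv kk hL) L kk r x))ᴴ)) := fun k => ctauS_coordMat_Ad_eq_conj (cvM d L mv kk hL) L kk r e he (hu' k) U'
  have hΨ : ∀ x' i j, |(kingStairT (cvM d L mv kk hL) (L ^ r * L ^ kk) (L ^ r) (fun μ b => coordMat e (ContinuousLinearMap.mulLeftRight ℝ (Matrix m m ℂ) (U' μ b.1) (U' μ b.1)ᴴ)) (x', 0))ᵀ i j| ≤ 1 := fun x' i j => abs_kingStairT_coordMat_Ad_transpose_le_one (cvM d L mv kk hL) L kk r e he hU' (x', 0) i j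
  have hSin : ∀ k x' i, ∑ j, |(scPsi' d L mv kk r hL k x' • ((kingStairT (cvM d L mv kk hL) (L ^ r * L ^ kk) (L ^ r) (fun μ b => coordMat e (ContinuousLinearMap.mulLeftRight ℝ (Matrix m m ℂ) (u' k b.1 * U' μ b.1 * (u' k (b.1 + unitVec (fine (L ^ r * L ^ kk) (cvM d L mv kk hL)) μ))ᴴ) (u' k b.1 * U' μ b.1 * (u' k (b.1 + unitVec (fine (L ^ r * L ^ kk) (cvM d L mv kk hL)) μ))ᴴ)ᴴ)) (x', 0))ᵀ - 1)) i j| ≤ sS := fun k x' i => smear_cols_kingStairT_coordMat_Ad_transpose_sub_one_le (cvM d L mv kk hL) L kk r e hLr (u' k) U' hρ0 (cvSk d L mv kk hL k) (hρ k) (ψ := scPsi' d L mv kk r hL k) (fun x' => abs_chiCube_le_one _ _) (fun x' hx => by rw [← blockOf_kingPr (cvM d L mv kk hL) L kk r x']; exact scBlk_kingPr_mem_cvSk_of_scPsi'_ne_zero hx) x' i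
  have hSout : ∀ k x' i, ∑ j, |(scPsi d L mv kk hL k ((kingPr L kk r (cvM d L mv kk hL)) x') • ((kingStairT (cvM d L mv kk hL) (L ^ r * L ^ kk) (L ^ r) (fun μ b => coordMat e (ContinuousLinearMap.mulLeftRight ℝ (Matrix m m ℂ) (u' k b.1 * U' μ b.1 * (u' k (b.1 + unitVec (fine (L ^ r * L ^ kk) (cvM d L mv kk hL)) μ))ᴴ) (u' k b.1 * U' μ b.1 * (u' k (b.1 + unitVec (fine (L ^ r * L ^ kk) (cvM d L mv kk hL)) μ))ᴴ)ᴴ)) (x', 0))ᵀ - 1)) i j| ≤ sS := fun k x' i => smear_cols_kingStairT_coordMat_Ad_transpose_sub_one_le_kingPr (cvM d L mv kk hL) L kk r e hLr (u' k) U' hρ0 (cvSk d L mv kk hL k) (hρ k) (ψo := scPsi d L mv kk hL k) (fun x => abs_chiCube_le_one _ _) (fun x hx => scBlk_mem_cvSk_of_scPsi_ne_zero hx) x' i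
  have hΔψ' := fun k => mulOp_scH'_comp_conj_comp_mulOp_scPsi' ι hM hmar₂ hfitm₂ hS0 η' (gaugePair (scShift' d L mv kk r hL) (fun μ x => coordMat e (ContinuousLinearMap.mulLeftRight ℝ (Matrix m m ℂ) (U' μ x) (U' μ x)ᴴ))) (fun x => coordMat e (ContinuousLinearMap.mulLeftRight ℝ (Matrix m m ℂ) (u' k x) (u' k x)ᴴ)) (fun x => (coordMat e (ContinuousLinearMap.mulLeftRight ℝ (Matrix m m ℂ) (u' k x) (u' k x)ᴴ))ᵀ) P' k (hhχ' k) (hPloc' k); have hLip : ∀ k, ∀ y y', |(coverHb (cvM d L mv kk hL) (L ^ kk) (L ^ mv) L k) y - (coverHb (cvM d L mv kk hL) (L ^ kk) (L ^ mv) L k) y'| ≤ (π * (d + 1) / W) * (unitTorusGeo L kk (cvM d L mv kk hL)).dist y y' := fun k y y' => abs_coverHb_sub_le hM hw k y y'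
  have hDAfη : ∀ k μ x, scChi d L mv kk hL k x ≠ 0 → ∀ i, ∑ j, |fgradMat ((((L ^ kk : ℕ) : ℝ))⁻¹)⁻¹ ((scShift d L mv kk hL) μ) ((tCoefA ((((L ^ kk : ℕ) : ℝ))⁻¹) (gaugePair (scShift d L mv kk hL) fun μ x => coordMat e (ContinuousLinearMap.mulLeftRight ℝ (Matrix m m ℂ) (u' k ((kingSec (cvM d L mv kk hL) L kk r) x) * U μ x * (u' k ((kingSec (cvM d L mv kk hL) L kk r) ((scShift d L mv kk hL) μ x)))ᴴ) (u' k ((kingSec (cvM d L mv kk hL) L kk r) x) * U μ x * (u' k ((kingSec (cvM d L mv kk hL) L kk r) ((scShift d L mv kk hL) μ x)))ᴴ)ᴴ))) (Sum.inl μ)) x i j| ≤ rD := (by simpa only [inv_inv] using hDAf)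
  have hDAbη : ∀ k μ x, scChi d L mv kk hL k x ≠ 0 → ∀ i, ∑ j, |fgradMat ((((L ^ kk : ℕ) : ℝ))⁻¹)⁻¹ ((scShift d L mv kk hL) μ) ((tCoefA ((((L ^ kk : ℕ) : ℝ))⁻¹) (gaugePair (scShift d L mv kk hL) fun μ x => coordMat e (ContinuousLinearMap.mulLeftRight ℝ (Matrix m m ℂ) (u' k ((kingSec (cvM d L mv kk hL) L kk r) x) * U μ x * (u' k ((kingSec (cvM d L mv kk hL) L kk r) ((scShift d L mv kk hL) μ x)))ᴴ) (u' k ((kingSec (cvM d L mv kk hL) L kk r) x) * U μ x * (u' k ((kingSec (cvM d L mv kk hL) L kk r) ((scShift d L mv kk hL) μ x)))ᴴ)ᴴ))) (Sum.inr μ)) x i j| ≤ rD := (by simpa only [inv_inv] using hDAb)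
  have hEcovη : ∀ k, mmulOp (fun x => coordMat e (ContinuousLinearMap.mulLeftRight ℝ (Matrix m m ℂ) (u' k ((kingSec (cvM d L mv kk hL) L kk r) x)) (u' k ((kingSec (cvM d L mv kk hL) L kk r) x))ᴴ)) ∘ₗ E ∘ₗ mmulOp (fun x => (coordMat e (ContinuousLinearMap.mulLeftRight ℝ (Matrix m m ℂ) (u' k ((kingSec (cvM d L mv kk hL) L kk r) x)) (u' k ((kingSec (cvM d L mv kk hL) L kk r) x))ᴴ))ᵀ) = mmulOp (RE k) ∘ₗ bgrad ((((L ^ kk : ℕ) : ℝ))⁻¹)⁻¹ (liftEquiv ((scShift d L mv kk hL) ν) ι) + mmulOp (BE k) := (by simpa only [inv_inv] using hEcov); have hRE'η : ∀ k x, scChi d L mv kk hL k x ≠ 0 → ∀ i, ∑ j, |(fgradMat ((((L ^ kk : ℕ) : ℝ))⁻¹)⁻¹ ((scShift d L mv kk hL) ν) (RE k)) x i j| ≤ rR' := (by simpa only [inv_inv] using hRE')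
  have hDAf'η : ∀ k μ x, scChi' d L mv kk r hL k x ≠ 0 → ∀ i, ∑ j, |fgradMat ((((L ^ r * L ^ kk : ℕ) : ℝ))⁻¹)⁻¹ ((scShift' d L mv kk r hL) μ) ((tCoefA ((((L ^ r * L ^ kk : ℕ) : ℝ))⁻¹) (gaugePair (scShift' d L mv kk r hL) fun μ x => coordMat e (ContinuousLinearMap.mulLeftRight ℝ (Matrix m m ℂ) (u' k x * U' μ x * (u' k ((scShift' d L mv kk r hL) μ x))ᴴ) (u' k x * U' μ x * (u' k ((scShift' d L mv kk r hL) μ x))ᴴ)ᴴ))) (Sum.inl μ)) x i j| ≤ rD := (by simpa only [inv_inv] using hDAf')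
  have hDAb'η : ∀ k μ x, scChi' d L mv kk r hL k x ≠ 0 → ∀ i, ∑ j, |fgradMat ((((L ^ r * L ^ kk : ℕ) : ℝ))⁻¹)⁻¹ ((scShift' d L mv kk r hL) μ) ((tCoefA ((((L ^ r * L ^ kk : ℕ) : ℝ))⁻¹) (gaugePair (scShift' d L mv kk r hL) fun μ x => coordMat e (ContinuousLinearMap.mulLeftRight ℝ (Matrix m m ℂ) (u' k x * U' μ x * (u' k ((scShift' d L mv kk r hL) μ x))ᴴ) (u' k x * U' μ x * (u' k ((scShift' d L mv kk r hL) μ x))ᴴ)ᴴ))) (Sum.inr μ)) x i j| ≤ rD := (by simpa only [inv_inv] using hDAb'); have hEcovfη : ∀ k, mmulOp (fun x => coordMat e (ContinuousLinearMap.mulLeftRight ℝ (Matrix m m ℂ) (u' k x) (u' k x)ᴴ)) ∘ₗ Ef ∘ₗ mmulOp (fun x => (coordMat e (ContinuousLinearMap.mulLeftRight ℝ (Matrix m m ℂ) (u' k x) (u' k x)ᴴ))ᵀ) = mmulOp (REf k) ∘ₗ bgrad ((((L ^ r * L ^ kk : ℕ) : ℝ))⁻¹)⁻¹ (liftEquiv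 ((scShift' d L mv kk r hL) ν) ι) + mmulOp (BEf k) := (by simpa only [inv_inv] using hEcovf)
  have hREf'η : ∀ k x, scChi' d L mv kk r hL k x ≠ 0 → ∀ i, ∑ j, |(fgradMat ((((L ^ r * L ^ kk : ℕ) : ℝ))⁻¹)⁻¹ ((scShift' d L mv kk r hL) ν) (REf k)) x i j| ≤ rR' := (by simpa only [inv_inv] using hREf')
  have hfgAfη : ∀ k μ x' i, ∑ j, |fgradMat ((((L ^ r * L ^ kk : ℕ) : ℝ))⁻¹)⁻¹ ((scShift' d L mv kk r hL) μ) (fun x => (scBump' d L mv kk r hL k x • (tCoefA ((((L ^ r * L ^ kk : ℕ) : ℝ))⁻¹) (gaugePair (scShift' d L mv kk r hL) fun μ x => coordMat e (ContinuousLinearMap.mulLeftRight ℝ (Matrix m m ℂ) (u' k x * U' μ x * (u' k ((scShift' d L mv kk r hL) μ x))ᴴ) (u' k x * U' μ x * (u' k ((scShift' d L mv kk r hL) μ x))ᴴ)ᴴ))) (Sum.inl μ) x)) (((scShift' d L mv kk r hL) μ).symm x') i j - fgradMat ((((L ^ kk : ℕ) : ℝ))⁻¹)⁻¹ ((scShift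 d L mv kk hL) μ) (fun x => (scBump d L mv kk hL k x • (tCoefA ((((L ^ kk : ℕ) : ℝ))⁻¹) (gaugePair (scShift d L mv kk hL) fun μ x => coordMat e (ContinuousLinearMap.mulLeftRight ℝ (Matrix m m ℂ) (u' k ((kingSec (cvM d L mv kk hL) L kk r) x) * U μ x * (u' k ((kingSec (cvM d L mv kk hL) L kk r) ((scShift d L mv kk hL) μ x)))ᴴ) (u' k ((kingSec (cvM d L mv kk hL) L kk r) x) * U μ x * (u' k ((kingSec (cvM d L mv kk hL) L kk r) ((scShift d L mv kk hL) μ x)))ᴴ)ᴴ))) (Sum.inl μ) x)) (((scShift d L mv kk hL) μ).symm ((kingPr L kk r (cvM d L mv kk hL)) x')) i j| ≤ og := (by simpa only [inv_inv] using hfgAf)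
  have hfgAbη : ∀ k μ x' i, ∑ j, |fgradMat ((((L ^ r * L ^ kk : ℕ) : ℝ))⁻¹)⁻¹ ((scShift' d L mv kk r hL) μ) (fun x => (scBump' d L mv kk r hL k x • (tCoefA ((((L ^ r * L ^ kk : ℕ) : ℝ))⁻¹) (gaugePair (scShift' d L mv kk r hL) fun μ x => coordMat e (ContinuousLinearMap.mulLeftRight ℝ (Matrix m m ℂ) (u' k x * U' μ x * (u' k ((scShift' d L mv kk r hL) μ x))ᴴ) (u' k x * U' μ x * (u' k ((scShift' d L mv kk r hL) μ x))ᴴ)ᴴ))) (Sum.inr μ) x)) x' i j - fgradMat ((((L ^ kk : ℕ) : ℝ))⁻¹)⁻¹ ((scShift d L mv kk hL) μ) (fun x => (scBump d L mv kk hL k x • (tCoefA ((((L ^ kk : ℕ) : ℝ))⁻¹) (gaugePair (scShift d L mv kk hL) fun μ x => coordMat e (ContinuousLinearMap.mulLeftRight ℝ (Matrix m m ℂ) (u' k ((kingSec (cvM d L mv kk hL) L kk r) x) * U μ x * (u' k ((kingSec (cvM d L mv kk hL) L kk r) ((scShift d L mv kk hL) μ x)))ᴴ) (u' k ((kingSec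 (cvM d L mv kk hL) L kk r) x) * U μ x * (u' k ((kingSec (cvM d L mv kk hL) L kk r) ((scShift d L mv kk hL) μ x)))ᴴ)ᴴ))) (Sum.inr μ) x)) ((kingPr L kk r (cvM d L mv kk hL)) x') i j| ≤ og := (by simpa only [inv_inv] using hfgAb)
  have hfRE'η : ∀ k x' i, ∑ j, |(fun x' => scChi' d L mv kk r hL k x' • (fgradMat ((((L ^ r * L ^ kk : ℕ) : ℝ))⁻¹)⁻¹ ((scShift' d L mv kk r hL) ν) (REf k)) x') x' i j - (fun x => scChi d L mv kk hL k x • (fgradMat ((((L ^ kk : ℕ) : ℝ))⁻¹)⁻¹ ((scShift d L mv kk hL) ν) (RE k)) x) ((kingPr L kk r (cvM d L mv kk hL)) x') i j| ≤ oR' := (by simpa only [inv_inv] using hfRE')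
  have key := uN_hasMaj_idef_rightInverse_comp_localGauges_cov_tr (kingPr L kk r (cvM d L mv kk hL)) (X := ScX d L mv kk hL) (X' := ScX' d L mv kk r hL) (ι := ι) (J := Fin (d + 1)) (K := (Fin (d + 1) → ZMod (2 * L))) (g := unitTorusGeo L kk (cvM d L mv kk hL)) (blk := scBlk d L mv kk hL) (sec := kingSec (cvM d L mv kk hL) L kk r) (τ := scShift d L mv kk hL) (τ' := scShift' d L mv kk r hL) (ν := ν) (T := ctauS (cvM d L mv kk hL) L kk r (fun μ x' => coordMat e (ContinuousLinearMap.mulLeftRight ℝ (Matrix m m ℂ) (U' μ x') (U' μ x')ᴴ))) (σ := δs / 32) (cr := cr) (N := fun k => (mulOp (fun p : ScX d L mv kk hL × ι => scPsi d L mv kk hL k p.1) ∘ₗ scCube d L mv kk hL (aK a₀ (L : ℝ) kk * (((L ^ kk : ℕ) : ℝ)) ^ (d + 1)) ι k)) (N' := fun k => (mulOp (fun p : ScX' d L mv kk r hL × ι => scPsi' d L mv kk r hL k p.1) ∘ₗ scCube' d L mv kk r hL (aK a₀ (L : ℝ) (r + kk) * (((L ^ r * L ^ kk : ℕ) : ℝ))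 ^ (d + 1)) ι k)) (NL := scQQ d L mv kk hL (aK a₀ (L : ℝ) kk * (((L ^ kk : ℕ) : ℝ)) ^ (d + 1)) ι) (NL' := scQQ' d L mv kk r hL (aK a₀ (L : ℝ) (r + kk) * (((L ^ r * L ^ kk : ℕ) : ℝ)) ^ (d + 1)) ι) (St := fun k x' => (kingStairT (cvM d L mv kk hL) (L ^ r * L ^ kk) (L ^ r) (fun μ b => coordMat e (ContinuousLinearMap.mulLeftRight ℝ (Matrix m m ℂ) (u' k b.1 * U' μ b.1 * (u' k (b.1 + unitVec (fine (L ^ r * L ^ kk) (cvM d L mv kk hL)) μ))ᴴ) (u' k b.1 * U' μ b.1 * (u' k (b.1 + unitVec (fine (L ^ r * L ^ kk) (cvM d L mv kk hL)) μ))ᴴ)ᴴ)) (x', 0))) (Ψ := fun x' => (kingStairT (cvM d L mv kk hL) (L ^ r * L ^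
    kk) (L ^ r) (fun μ b => coordMat e (ContinuousLinearMap.mulLeftRight ℝ (Matrix m m ℂ) (U' μ b.1) (U' μ b.1)ᴴ)) (x', 0))) (χX := scChi d L mv kk hL) (χtX := scBump d L mv kk hL) (ψX := scPsi d L mv kk hL) (hX := scH d L mv kk hL) (ψo := scPsi d L mv kk hL) (χX' := scChi' d L mv kk r hL) (χtX' := scBump' d L mv kk r hL) (ψX' := scPsi' d L mv kk r hL) (hX' := scH' d L mv kk r hL) (Sk := cvSk d L mv kk hL) (hb := coverHb (cvM d L mv kk hL) (L ^ kk) (L ^ mv) L) (Tf := fun k μ => (mulOp (fun p : ScX d L mv kk hL × ι => scPsi d L mv kk hL k p.1) ∘ₗ ((Matrix.mulVecLin (cGreen (cvM d L mv kk hL) (L ^ kk) (fun (_ : Fin (d + 1)) (_ : ScX d L mv kk hL) => (1 : Matrix ι ι ℝ)) (aK a₀ (L : ℝ) kk * (((L ^ kk : ℕ) : ℝ)) ^ (d + 1)))) ∘ₗ fgrad ((((L ^ kk : ℕ) : ℝ))⁻¹)⁻¹ (liftEquiv (scShift d L mv kk hL μ) ι)) ∘ₗ mulOp (fun p : ScX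 d L mv kk hL × ι => scPsi d L mv kk hL k p.1))) (Tb := fun k μ => (mulOp (fun p : ScX d L mv kk hL × ι => scPsi d L mv kk hL k p.1) ∘ₗ ((Matrix.mulVecLin (cGreen (cvM d L mv kk hL) (L ^ kk) (fun (_ : Fin (d + 1)) (_ : ScX d L mv kk hL) => (1 : Matrix ι ι ℝ)) (aK a₀ (L : ℝ) kk * (((L ^ kk : ℕ) : ℝ)) ^ (d + 1)))) ∘ₗ bgrad ((((L ^ kk : ℕ) : ℝ))⁻¹)⁻¹ (liftEquiv (scShift d L mv kk hL μ) ι)) ∘ₗ mulOp (fun p : ScX d L mv kk hL × ι => scPsi d L mv kk hL k p.1))) (Tf' := fun k μ => (mulOp (fun p : ScX' d L mv kk r hL × ι => scPsi' d L mv kk r hL k p.1) ∘ₗ ((Matrix.mulVecLin (cGreen (cvM d L mv kk hL) (L ^ r * L ^ kk) (fun (_ : Fin (d + 1)) (_ : ScX' d L mv kk r hL) => (1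
    : Matrix ι ι ℝ)) (aK a₀ (L : ℝ) (r + kk) * (((L ^ r * L ^ kk : ℕ) : ℝ)) ^ (d + 1)))) ∘ₗ fgrad ((((L ^ r * L ^ kk : ℕ) : ℝ))⁻¹)⁻¹ (liftEquiv (scShift' d L mv kk r hL μ) ι)) ∘ₗ mulOp (fun p : ScX' d L mv kk r hL × ι => scPsi' d L mv kk r hL k p.1))) (Tb' := fun k μ => (mulOp (fun p : ScX' d L mv kk r hL × ι => scPsi' d L mv kk r hL k p.1) ∘ₗ ((Matrix.mulVecLin (cGreen (cvM d L mv kk hL) (L ^ r * L ^ kk) (fun (_ : Fin (d + 1)) (_ : ScX' d L mv kk r hL) => (1 : Matrix ι ι ℝ)) (aK a₀ (L : ℝ) (r + kk) * (((L ^ r * L ^ kk : ℕ) : ℝ)) ^ (d + 1)))) ∘ₗ bgrad ((((L ^ r * L ^ kk : ℕ) : ℝ))⁻¹)⁻¹ (liftEquiv (scShift' d L mv kk r hL μ) ι)) ∘ₗ mulOp (fun p : ScX' d L mv kk r hL × ι => scPsi' d L mv kk r hL k p.1))) (β := Cs) (β₁ := Cs) (ct := π / W) (δ := δT) (m := m)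 (e := e) (u' := u') (U := U) (U' := U') (P := P) (E := E) (Yop := Yop) (P' := P') (Ef := Ef) (Yop' := Yop') (NV := NV) (NV' := NV') (RE := RE) (BE := BE) (REf := REf) (BEf := BEf) (dh := dh) (dhf := dhf) (η := η) (η' := η') (hu' := hu') (htri := triangle254_unitTorusGeo L kk _) (hd := unitTorusGeo_dist_nonneg L kk _) (hd0 := unitTorusGeo_dist_self L kk _) (hsymm := unitTorusGeo_dist_symm L kk _) (hrow := hrowS) (hσ := by positivity) (ρ₁ := δs / 2) (ρ₂ := δs / 4) (ρ₃ := δs / 8) (ρN := δs / 2) (δV := δs) (ε := δs / 2) (R := R) (c₀ := π / W) (c₁ := π / W) (c₂ := 32 * π ^ 2 / W ^ 2) (cN := (π * (d + 1) / W * 0 + 2 * (π * (d + 1) / W)) * a₀) (ℓ := π * (d + 1) / W) (ω := π * (d + 1) / W) (βQ := βQ) (Nov := Nov) (hβ := hCs.le)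
    (hβ₁ := hCs.le) (hβQ := hβQ0) (hct := div_nonneg pi_pos.le hWpos.le) (hR := hR0.le) (hcr := hcr0) (hNov := hNov0) (hc₀ := div_nonneg pi_pos.le hWpos.le) (hc₁ := div_nonneg pi_pos.le hWpos.le) (hc₂ := div_nonneg (by positivity) (pow_nonneg hWpos.le 2)) (hcN := by positivity) (hℓ := div_nonneg (by positivity) hWpos.le) (hω := div_nonneg (by positivity) hWpos.le) (hε := by positivity) (hσρ := by linarith only [hδs0]) (hρ₁V := by linarith only [hδs0]) (hρ₁G := by rw [hδTdef]; linarith only [hδs0]) (hρ₂ := by positivity) (hρ₂₁ := by linarith only [hδs0]) (hρ₃ := by positivity) (hρ₃₂ := by linarith only [hδs0]) (hρ₃V := by linarith only [hδs0]) (hρ₃N := by linarith only [hδs0]) (hσρ₃ := by linarith only [hδs0]) (hLip := hLip) (hN := hN) (he := he) (rV := rV) (rD := rD) (RN := RN) (θF := θF) (ρF := δs) (hrV := hrV) (hrD := hrD) (hRN := hRN) (hθF := hθF0) (hρF := by linarith only [hδs0]) (hRle := hRle) (rR := rR) (rR' := rR') (rB := rB) (hrR := hrR) (hrR' := hrR')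 (hrB := hrB) (hqA := hsA) (hqL := hsmall.1) (hq := hq₀.trans_lt (by norm_num)) (hSχ := hSχ) (hSψ := hSψ) (hχt := hχt) (hχ1 := hχ1) (hdχt := hdχt) (hdχtb := hdχtb) (hsub := hsub) (hχ := hχ) (hs := hs) (hsb := hsb) (hdd := hdd) (hddb := hddb) (hNψ := hNψ) (hψχ := hψχ) (hcut := hcut) (hcutF := hcutF) (hcutB := hcutB) (hTf := hTf) (hTb := hTb) (hTfr := hTfr) (hTbr := hTbr) (hTfψ := hTfψ) (hTbψ := hTbψ) (hflat0 := hflat0) (hhabs := hhabs) (h236 := h236) (hhcut := hhcut) (hh1 := hh1) (hh1b := hh1b) (hh0 := hh0) (hrh := hrh)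
    (hh2 := hh2) (hh2f := hh2f) (hh2b := hh2b) (hlayf := hlayf) (hlayb := hlayb) (hlayν := hlayν) (hhψ := hhψ) (hχth := hχth) (hhts' := hhts') (hhtsb' := hhtsb') (hhtdd' := hhtdd') (hhtddb' := hhtddb') (hKN := hKN) (hP := hP) (hCloc := hCloc) (hAloc := hAloc) (hDAf := hDAfη) (hDAb := hDAbη) (hNVcut := hNVcut) (hfarN := hfarN) (hleib := hleib) (hdh := hdh) (hEcov := hEcovη) (hRE := hRE) (hRE' := hRE'η) (hBE := hBE) (hSχ' := fun k x hx => scBlk_kingPr_mem_cvSk_of_scChi'_ne_zero hM hm₁ hfitI hS0 hx) (hSψ' := fun k x hx => scBlk_kingPr_mem_cvSk_of_scPsi'_ne_zero hx) (hχt' := hχtf9) (hχ1' := hχ1f9) (hdχt' := hdχtf9) (hdχtb' := hdχtbf9) (hsub' := hsubf9) (hχ' := hχf9) (hs' := hsf9) (hsb' := hsbf9) (hdd' := hddf9) (hddb' := hddbf9) (hNψ' := hNψf9) (hψχ' := hψχf9) (hcut' := hcutT') (hcutF' := hcutFT') (hcutB' := hcutBT') (hTf' := hTff9) (hTb' :=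 hTbf9) (hTfr' := hTfrT') (hTbr' := hTbrT') (hTfψ' := hTfψf9) (hTbψ' := hTbψf9) (hflat0' := hflat0f9) (hhabs' := hhabsf9) (h236' := h236f9) (hhcut' := hhcutf9) (hh1' := hh1f9) (hh1b' := hh1bf9) (hh0' := hh0f9) (hrh' := fun k x' => abs_scH'_sub_coverHb_kingPr_le PUnit hM hw k (x', PUnit.unit)) (hh2' := hh2f9) (hh2f' := hh2ff9) (hh2b' := hh2bf9) (hlayf' := hlayff9) (hlayb' := hlaybf9) (hlayν' := hlayνf9) (hhψf := hhψf9) (hχthf := hχthf9) (hhtsf := hhts'f9) (hhtsbf := hhtsb'f9) (hhtddf := hhtdd'f9) (hhtddbf := hhtddb'f9) (hKN' := hKNT') (hP' := hP') (hCloc' := hCloc') (hAloc' := hAloc') (hDAf' := hDAf'η) (hDAb' := hDAb'η) (hNVcut' := hNVcut')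
    (hfarN' := hfarN') (hleib' := hleib') (hdhf := hdhf) (hEcovf := hEcovfη) (hREf := hREf) (hREf' := hREf'η) (hBEf := hBEf) (m₀ := Cs * εk) (m₁ := Cs * εk) (oχ := π * (d + 1) / (((L ^ kk : ℕ) : ℝ) * W)) (oχ₁ := 2 * (π * (d + 1) / (((L ^ kk : ℕ) : ℝ) * W))) (oχ₂ := (W)⁻¹ * (((L ^ kk : ℕ) : ℝ) * W)⁻¹ * (32 * π ^ 4 + π ^ 2 * (d + 1))) (mQ := Cs * εk) (mQc := Cs * εk) (oC := oC) (oA := oA) (og := og) (oN := oN) (o := π * (d + 1) / (((L ^ kk : ℕ) : ℝ) * W)) (os := π * (d + 1) / (((L ^ kk : ℕ) : ℝ) * W) + (π / W) / η⁻¹) (od := od) (o₀ := (π / W) / η⁻¹ + (π / W) / η'⁻¹) (o₁ := O1) (o₂ := O2) (rN := RNK) (rfa := rfa) (oR := oR) (oR' := oR') (oB := oB) (s := sS) (hm₀ := mul_nonneg hCs.le hεk0) (hm₁ := mul_nonneg hCs.le hεk0) (hoχ := hoχ0) (hoχ₁ := mul_nonneg zero_le_two hoχ0) (hoχ₂ :=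 hoχ₂0) (hmQ := mul_nonneg hCs.le hεk0) (hmQc := mul_nonneg hCs.le hεk0) (hoC := hoC) (hoA := hoA) (hog := hog) (hoN := hoN) (ho := hoχ0) (hos := add_nonneg hoχ0 hDη00) (hod := hod) (ho₀ := add_nonneg hDη00 hDη10) (ho₁ := ho₁0) (ho₂ := ho₂0) (hrN := hRNK0) (hrfa := hrfa) (hoR := hoR) (hoR' := hoR') (hoB := hoB) (hs0 := hsS0) (hfitχ := hfitχ) (hfit₁ := hfit₁) (hfit₁b := hfit₁b) (hfit₂ := hfit₂) (hfit₂b := hfit₂b) (hχπ := hχπ) (hχχ := hχχ) (hχχ' := hχχ') (hDcut := hDcut) (hDcutF := hDcutF) (hDcutB := hDcutB) (hDTf := hDTf) (hDTb := hDTb) (hITf := hITf) (hITb := hITb) (hhD := hhD) (hhB := hhB) (hfD := hfD) (hfB := hfB) (hf2f := hf2f) (hf2b := hf2b) (hf1 := hf1) (hf1b := hf1b) (hf2 := hf2) (hf0 := hf0)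
    (hf0b := hf0b) (hfit := hfit) (hfits := hfits) (hDKN := hDKN2) (hfitCt := hfitCt) (hfitAt := hfitAt) (hfAsh1 := hfAsh1) (hfAsh2 := hfAsh2) (hfgAf := hfgAfη) (hfgAb := hfgAbη) (hDNVc := hDNVc) (hDfarNa := hDfarNa) (hfRE := hfRE) (hfRE' := hfRE'η) (hfBE := hfBE) (hfdh := hfdh) (hTk := hTk) (hT0 := rfl) (hΨ := hΨ) (hψoχt := hψoχt) (hψoχ := hψχ) (hψ'χ' := hψ'χ') (hΔψ' := hΔψ') (hSin := hSin) (hSout := hSout) (hY := hY) (hY' := hY') (hqL2 := hsmall.1)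
  have hsm := adjSmall427R (Nov := Nov) (cι2 := cι2) (cι := cι) (cJ := (Fintype.card (Fin (d + 1)) : ℝ)) (cJJ := cJJ) (β := Cs) (β₁ := Cs) (βQ := βQ) (R := R) (cr := cr) (ct := π / W) (c₀ := π / W) (c₁ := π / W) (c₂ := 32 * π ^ 2 / W ^ 2) (cN := (π * (d + 1) / W * 0 + 2 * (π * (d + 1) / W)) * a₀) (θF := θF) (rV := rV) (rD := rD) (RN := RN) (rR := rR) (rR' := rR') (rB := rB) (ℓ := π * (d + 1) / W) (ε := δs / 2) (ω := π * (d + 1) / W) (m₀ := Cs * εk) (m₁ := Cs * εk) (oχ := π * (d + 1) / (((L ^ kk : ℕ) : ℝ) * W)) (oχ₁ := 2 * (π * (d + 1) / (((L ^ kk : ℕ) : ℝ) * W))) (oχ₂ := (W)⁻¹ * (((L ^ kk : ℕ) : ℝ) * W)⁻¹ * (32 * π ^ 4 + π ^ 2 * (d + 1))) (mQ := Cs * εk) (mQc := Cs * εk) (oC := oC) (oA := oA) (og := og) (oN := oN) (o := π * (d + 1) / (((L ^ kk : ℕ) : ℝ) * W)) (os := π * (d + 1) / (((L ^ kk : ℕ)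 : ℝ) * W) + (π / W) / η⁻¹) (od := od) (o₀ := (π / W) / η⁻¹ + (π / W) / η'⁻¹) (o₁ := O1) (o₂ := O2) (rN := RNK) (rfa := rfa) (oR := oR) (oR' := oR') (oB := oB) (s := sS) (S := Sdef) (ctb := π) (c₀b := π) (c₁b := π) (c₂b := (32 * π ^ 2)) (cNb := ((π * (d + 1) * 0 + 2 * (π * (d + 1))) * a₀)) (θFb := θ₀) (rVb := R) (rDb := R) (RNb := R) (rRb := Rb) (rRpb := Rb) (rBb := Rb) (LRb := (π * (d + 1) * E' + 2 * (π * (d + 1)))) (km₀ := Cs) (km₁ := Cs) (koχ := (π * (d + 1))) (koχ₁ := (2 * (π * (d + 1)))) (koχ₂ := (32 * π ^ 4 + π ^ 2 * (d + 1))) (kmQ := Cs) (kmQc := Cs) (koC := 1) (koA := 1) (kog := 1) (koN := 1) (ko := (π * (d + 1))) (kos := (π * (d + 1) + π)) (kod := 1) (ko₀ := (π + π)) (ko₁ :=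
    (64 * π ^ 2 + π ^ 2 * cJ)) (ko₂ := (144 * π ^ 3 + 32 * π ^ 3 * cJ)) (krN := KRN) (krfa := 1) (koR := 1) (koRp := 1) (koB := 1) (ks := 1)
    hNov0 hcι20 (Nat.cast_nonneg _) (Nat.cast_nonneg _) (Nat.cast_nonneg _) hCs.le hCs.le hβQ0 hR0.le hcr0 (div_nonneg pi_pos.le hWpos.le) (div_le_self pi_pos.le hW1) (div_nonneg pi_pos.le hWpos.le) (div_le_self pi_pos.le hW1) (div_nonneg pi_pos.le hWpos.le) (div_le_self pi_pos.le hW1) (div_nonneg (by positivity) (pow_nonneg hWpos.le 2)) (div_le_self (by positivity) (by nlinarith only [hW1])) (by positivity) hcNb hθF0 hθle hrV hrVR hrD hrDle hRN hRNR hrR hrRb hrR' hrR'b hrB hrBb (cv_inv_le_two hq₀).1 (cv_inv_le_two hq₀).2 (cv_inv_le_two' hq₀).1 (cv_inv_le_two' hq₀).2 (cv_inv_le_two hθA).1 (cv_inv_le_two hθA).2 (by positivity) hLRb (inv_nonneg.mpr (sub_nonneg.mpr hsmall.1.le)) hsmall.2.1 (mul_nonneg hCs.le hεk0) hsm₀ (mul_nonneg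 hCs.le hεk0) hsm₀ hoχ0 hsoχ (mul_nonneg zero_le_two hoχ0) hsoχ₁ hoχ₂0 hsoχ₂ (mul_nonneg hCs.le hεk0) hsm₀ (mul_nonneg hCs.le hεk0) hsm₀ hoC (hof oC hoC hle9.1) hoA (hof oA hoA hle9.2.1) hog (hof og hog hle9.2.2.1) hoN (hof oN hoN hle9.2.2.2.1) hoχ0 hsoχ (add_nonneg hoχ0 hDη00) hsos hod (hof od hod hle9.2.2.2.2.2.2.2.2) (add_nonneg hDη00 hDη10) hso0 ho₁0 hso₁ ho₂0 hso₂ hRNK0 hsRN hrfa (hof rfa hrfa hle9.2.2.2.2.1) hoR (hof oR hoR hle9.2.2.2.2.2.1) hoR' (hof oR' hoR' hle9.2.2.2.2.2.2.1) hoB (hof oB hoB hle9.2.2.2.2.2.2.2.1) hsS0 hss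
  refine key.mono fun y y' => ?_
  exact mul_le_mul (by convert hsm.2 using 3) (Real.exp_le_exp.mpr (le_of_eq (by ring))) (Real.exp_nonneg _) (by convert (hsm.1.trans hsm.2) using 2)

end Knit

end Summit.QuantumFields.YangMills.BalabanUVNodes.N15.Gluing

end
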